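import Literature.Topology.FourManifolds.SeparatingNeckSurgery
import Literature.Topology.FourManifolds.SurgeryGluePrelim
import Literature.AlgebraicTopology.FundamentalGroup.SphereCoreComplementPi1
import Literature.AlgebraicTopology.FundamentalGroupoid.SimplyConnectedComplPoint
import Literature.AlgebraicTopology.FundamentalGroup.CircleAndTorus
import Literature.AlgebraicTopology.FundamentalGroup.VanKampenTwoComponents
import Literature.AlgebraicTopology.FundamentalGroup.SphereSimplyConnected
import HarnessLib

/-!
# Surgery along a non-separating neck: the double cap

Topic `Literature/Topology/FourManifolds`.  Companion of `SeparatingNeckSurgery.lean` (the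
separating case) for the reduction of
`Literature.Topology.FourManifolds.kneserMilnor_retract_alternative` to the Sphere Theorem
(`KneserMilnorRetractViaRank.lean`).  Let `ψ : 𝕊ⁿ × ℝ ↪ Y` be a neck (an open smooth
embedding) in a closed connected manifold `Y` whose middle sphere `S = ψ (𝕊ⁿ × 0)` does **not**
separate, i.e. `Y ∖ S` is connected.  Cutting `Y` along `S` and capping the two resulting
boundary spheres by discs gives a closed connected manifold `M`, orientable with `Y`
(Hempel, *3-Manifolds* (1976), Lemma 3.8 and the discussion before Thm. 3.15; Milnor 1962, §1:
"`Y ≅ M # (𝕊ⁿ × 𝕊¹)`, or `M # (𝕊ⁿ ×~ 𝕊¹)`").  We construct `M` with the neck-capping datum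
`Literature.Topology.FourManifolds.NeckCapData` used twice:

* first cap (`capOne`): in the open submanifold `P₁ = Y ∖ S` the re-parametrised neck
  `ψ₁ (θ, t) = ψ (θ, 1 + σ t)` (`σ = intervalStretch 2 : ℝ ≅ (-1, 2)`, the identity on `[0, 1]`)
  has the side `A₁ = Y ∖ ψ (𝕊ⁿ × [0, 1])`; its cap is `Q = A₁ ∪ 𝔻`;
* second cap (`capTwo`): in `Q` the neck `ψ₂ (θ, t) = inl ψ (θ, -1 - σ t)` has the side
  `A₂ = inl (Y ∖ ψ (𝕊ⁿ × [-1, 1])) ∪ (first disc)`; its cap is `M`.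

Results (`n ≥ 1` throughout, `n = 2` for the fundamental group):

* `DoubleCap.compactSpace`, `DoubleCap.connectedSpace`, `DoubleCap.isOrientable`,
  `DoubleCap.secondCountableTopology` — `M` is a closed connected manifold, orientable if `Y` is;
* `isPreconnected_compl_image_neck_Icc` — `Y ∖ ψ (𝕊ⁿ × [-1, 1])` is connected when `Y ∖ S` is;
* `DoubleCap.exists_mulEquiv_fundamentalGroup` — `π₁ (Y ∖ ψ (𝕊ⁿ × [-1, 1])) ≅ π₁ (M)`
  (`n + 1 ≥ 3`: filling in two points does not change `π₁`,
  `Literature.AlgebraicTopology.FundamentalGroup.VanKampen.bijective_inclHom_compl_core`).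

The identification `π₁ (Y) ≅ π₁ (M) ∗ ℤ` (Seifert–van Kampen for the cover of `Y` by
`Y ∖ ψ (𝕊ⁿ × [-1, 1])` and `ψ (𝕊ⁿ × (-2, 2))`, meeting in two collars) is completed in the
sequel with `VanKampenTwoComponents.lean`.  Everything is proved; no named facts.

## References

* J. Hempel, *3-Manifolds*, Ann. of Math. Studies 86 (1976), Ch. 3, Lemma 3.8, Thm. 3.15.
  [Hempel1976]
* J. Milnor, *A unique decomposition theorem for 3-manifolds*, Amer. J. Math. 84 (1962) 1–7, §1.
* A. Kosinski, *Differential Manifolds* (1993), Ch. VI §1–2. [Kosinski1993]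
-/

noncomputable section

open scoped Manifold ContDiff Topology
open Set Function Metric Module Topology

universe u

namespace Literature.Topology.FourManifolds

/-! ### Re-parametrising a neck: `(θ, t) ↦ ψ (θ, a σ(t) + b)` -/

section Reneck

variable {E : Type*} [NormedAddCommGroup E] [InnerProductSpace ℝ E] {n : ℕ}
  [Fact (finrank ℝ E = n + 1)] {P : Type*} [TopologicalSpace P] [ChartedSpace E P]

/-- The affine change of height `(θ, t) ↦ (θ, a t + b)` (`a ≠ 0`) as a globally defined open
partial homeomorphism of `𝕊ⁿ × ℝ`. [folklore] -/
def affineTubePH (a b : ℝ) (ha : a ≠ 0) :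
    OpenPartialHomeomorph (sphere (0 : E) 1 × ℝ) (sphere (0 : E) 1 × ℝ) :=
  ((Homeomorph.refl _).prodCongr (affineHomeomorph a b ha)).toOpenPartialHomeomorph

omit [InnerProductSpace ℝ E] [Fact (finrank ℝ E = n + 1)] in
/-- `affineTubePH a b` acts as `(θ, t) ↦ (θ, a t + b)`. [folklore] -/
@[simp] theorem affineTubePH_apply (a b : ℝ) (ha : a ≠ 0) (q : sphere (0 : E) 1 × ℝ) :
    affineTubePH a b ha q = (q.1, a * q.2 + b) := rfl

omit [InnerProductSpace ℝ E] [Fact (finrank ℝ E = n + 1)] in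
/-- The inverse of `affineTubePH a b` acts as `(θ, s) ↦ (θ, (s - b) / a)`. [folklore] -/
theorem affineTubePH_symm_apply (a b : ℝ) (ha : a ≠ 0) (q : sphere (0 : E) 1 × ℝ) :
    (affineTubePH a b ha).symm q = (q.1, (q.2 - b) / a) := rfl

omit [InnerProductSpace ℝ E] [Fact (finrank ℝ E = n + 1)] in
/-- The source of `affineTubePH` is everything. [folklore] -/
theorem affineTubePH_source (a b : ℝ) (ha : a ≠ 0) :
    (affineTubePH (E := E) a b ha).source = univ := rfl

omit [InnerProductSpace ℝ E] [Fact (finrank ℝ E = n + 1)] in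
/-- The target of `affineTubePH` is everything. [folklore] -/
theorem affineTubePH_target (a b : ℝ) (ha : a ≠ 0) :
    (affineTubePH (E := E) a b ha).target = univ := rfl

/-- The affine change of height is smooth. [folklore] -/
theorem contMDiffOn_affineTubePH (a b : ℝ) (ha : a ≠ 0) :
    ContMDiffOn ((𝓡 n).prod 𝓘(ℝ, ℝ)) ((𝓡 n).prod 𝓘(ℝ, ℝ)) ∞ (affineTubePH (E := E) a b ha)
      (affineTubePH (E := E) a b ha).source := by
  have h : ContMDiff ((𝓡 n).prod 𝓘(ℝ, ℝ)) ((𝓡 n).prod 𝓘(ℝ, ℝ)) ∞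
      (fun q : sphere (0 : E) 1 × ℝ => (q.1, a * q.2 + b)) :=
    contMDiff_fst.prodMk ((contMDiff_iff_contDiff.2
      ((contDiff_const.mul contDiff_id).add contDiff_const)).comp contMDiff_snd)
  exact h.contMDiffOn

/-- Its inverse is smooth. [folklore] -/
theorem contMDiffOn_affineTubePH_symm (a b : ℝ) (ha : a ≠ 0) :
    ContMDiffOn ((𝓡 n).prod 𝓘(ℝ, ℝ)) ((𝓡 n).prod 𝓘(ℝ, ℝ)) ∞ (affineTubePH (E := E) a b ha).symm
      (affineTubePH (E := E) a b ha).target := by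
  have h : ContMDiff ((𝓡 n).prod 𝓘(ℝ, ℝ)) ((𝓡 n).prod 𝓘(ℝ, ℝ)) ∞
      (fun q : sphere (0 : E) 1 × ℝ => (q.1, (q.2 - b) / a)) :=
    contMDiff_fst.prodMk ((contMDiff_iff_contDiff.2
      ((contDiff_id.sub contDiff_const).div_const a)).comp contMDiff_snd)
  exact h.contMDiffOn

/-- **The re-parametrised neck** `(θ, t) ↦ ψ (θ, a σ(t) + b)`, `σ = intervalStretch 2`: a neck
whose heights run over the bounded window `a · (-1, 2) + b` of heights of `ψ`, with middle
sphere at height `b` and `ψ (θ, a t + b)` for `t ∈ [0, 1]`. [folklore] -/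
def reneck (ψ : sphere (0 : E) 1 × ℝ → P) (a b : ℝ) (ha : a ≠ 0) : sphere (0 : E) 1 × ℝ → P :=
  (ψ ∘ affineTubePH (E := E) a b ha) ∘ tubeStretchPH (E := E) one_lt_two

omit [InnerProductSpace ℝ E] [Fact (finrank ℝ E = n + 1)] [TopologicalSpace P]
  [ChartedSpace E P] in
/-- Unfolding of `reneck`: `(θ, t) ↦ ψ (θ, a σ(t) + b)`. [folklore] -/
theorem reneck_apply (ψ : sphere (0 : E) 1 × ℝ → P) (a b : ℝ) (ha : a ≠ 0)
    (θ : sphere (0 : E) 1) (t : ℝ) :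
    reneck ψ a b ha (θ, t) = ψ (θ, a * intervalStretch 2 t + b) := rfl

omit [InnerProductSpace ℝ E] [Fact (finrank ℝ E = n + 1)] [TopologicalSpace P]
  [ChartedSpace E P] in
/-- On `t ∈ [0, 1]` the re-parametrised neck is `ψ (θ, a t + b)`. [folklore] -/
theorem reneck_apply_of_mem_Icc (ψ : sphere (0 : E) 1 × ℝ → P) (a b : ℝ) (ha : a ≠ 0)
    (θ : sphere (0 : E) 1) {t : ℝ} (ht : t ∈ Icc (0 : ℝ) 1) :
    reneck ψ a b ha (θ, t) = ψ (θ, a * t + b) := by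
  rw [reneck_apply, intervalStretch_of_mem_Icc one_lt_two ht]

/-- The re-parametrised neck of a smooth embedding is a smooth embedding. [folklore] -/
theorem isSmoothEmbedding_reneck [IsManifold 𝓘(ℝ, E) ∞ P] {ψ : sphere (0 : E) 1 × ℝ → P}
    (hψ : Manifold.IsSmoothEmbedding ((𝓡 n).prod 𝓘(ℝ, ℝ)) 𝓘(ℝ, E) ∞ ψ) (a b : ℝ) (ha : a ≠ 0) :
    Manifold.IsSmoothEmbedding ((𝓡 n).prod 𝓘(ℝ, ℝ)) 𝓘(ℝ, E) ∞ (reneck ψ a b ha) :=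
  (hψ.comp_openPartialHomeomorph _ (affineTubePH_source a b ha) (contMDiffOn_affineTubePH a b ha)
    (contMDiffOn_affineTubePH_symm a b ha)).comp_tubeStretch one_lt_two

omit [InnerProductSpace ℝ E] [Fact (finrank ℝ E = n + 1)] [TopologicalSpace P]
  [ChartedSpace E P] in
/-- The range of the re-parametrised neck is `ψ (𝕊ⁿ × (a · (-1, 2) + b))`. [folklore] -/
theorem range_reneck (ψ : sphere (0 : E) 1 × ℝ → P) (a b : ℝ) (ha : a ≠ 0) :
    range (reneck ψ a b ha) = ψ '' (univ ×ˢ ((fun t => a * t + b) '' Ioo (-1 : ℝ) 2)) := by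
  rw [reneck, range_comp_tubeStretch, image_comp, show (1 : ℝ) - 2 = -1 by norm_num]
  congr 1
  ext ⟨θ, s⟩
  simp only [mem_image, mem_prod, mem_univ, true_and, affineTubePH_apply, Prod.mk.injEq,
    Prod.exists]
  constructor
  · rintro ⟨θ', t, ht, rfl, rfl⟩
    exact ⟨t, ht, rfl⟩
  · rintro ⟨t, ht, rfl⟩
    exact ⟨θ, t, ht, rfl, rfl⟩

omit [InnerProductSpace ℝ E] [Fact (finrank ℝ E = n + 1)] [TopologicalSpace P]
  [ChartedSpace E P] in
/-- Every point of the re-parametrised neck is a point `ψ (θ, s)` with `s ∈ a · (-1, 2) + b`.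
[folklore] -/
theorem reneck_eq (ψ : sphere (0 : E) 1 × ℝ → P) (a b : ℝ) (ha : a ≠ 0)
    (θ : sphere (0 : E) 1) (t : ℝ) :
    ∃ s ∈ Ioo (-1 : ℝ) 2, reneck ψ a b ha (θ, t) = ψ (θ, a * s + b) ∧ (0 < t ↔ 0 < s) ∧
      (t = 0 ↔ s = 0) := by
  refine ⟨intervalStretch 2 t, ?_, rfl, ?_, ?_⟩
  · have h := intervalStretch_mem_Ioo one_lt_two t
    rwa [show (1 : ℝ) - 2 = -1 by norm_num] at h
  · have h0 : intervalStretch 2 0 = 0 := intervalStretch_of_mem_Icc one_lt_two ⟨le_rfl, zero_le_one⟩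
    constructor
    · intro ht
      have := strictMono_intervalStretch one_lt_two ht
      rwa [h0] at this
    · intro hs
      by_contra ht
      have := (strictMono_intervalStretch one_lt_two).monotone (not_lt.1 ht)
      rw [h0] at this
      exact absurd hs (not_lt.2 this)
  · have h0 : intervalStretch 2 0 = 0 := intervalStretch_of_mem_Icc one_lt_two ⟨le_rfl, zero_le_one⟩
    constructor
    · rintro rfl; exact h0
    · intro hs
      exact (injective_intervalStretch one_lt_two) (hs.trans h0.symm)

end Reneck

/-! ### Heights on a neck -/

section Heights

variable {S P : Type*} {ψ : S × ℝ → P}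

/-- A point `ψ (θ, t)` of an injective neck lies in `ψ (S × J)` iff `t ∈ J`. [folklore] -/
theorem mem_image_neck_iff (hinj : Injective ψ) {J : Set ℝ} {θ : S} {t : ℝ} :
    ψ (θ, t) ∈ ψ '' (univ ×ˢ J) ↔ t ∈ J := by
  constructor
  · rintro ⟨q, ⟨-, hq⟩, hqe⟩
    obtain rfl := hinj hqe
    exact hq
  · exact fun ht => ⟨(θ, t), ⟨mem_univ _, ht⟩, rfl⟩

/-- Two neck images `ψ (S × J)`, `ψ (S × J')` with disjoint `J`, `J'` are disjoint. [folklore] -/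
theorem disjoint_image_neck (hinj : Injective ψ) {J J' : Set ℝ} (h : Disjoint J J') :
    Disjoint (ψ '' (univ ×ˢ J)) (ψ '' (univ ×ˢ J')) := by
  rw [Set.disjoint_left]
  rintro _ ⟨⟨θ, t⟩, ⟨-, ht⟩, rfl⟩ h'
  exact Set.disjoint_left.1 h ht ((mem_image_neck_iff hinj).1 h')

/-- Monotonicity of neck images in the height window. [folklore] -/
theorem image_neck_mono (ψ : S × ℝ → P) {J J' : Set ℝ} (h : J ⊆ J') :
    ψ '' (univ ×ˢ J) ⊆ ψ '' (univ ×ˢ J') :=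
  image_mono (prod_mono le_rfl h)

end Heights

/-! ### Compactness of a capped side from a compact side piece -/

section CompactCriterion

variable {E : Type*} [NormedAddCommGroup E] [InnerProductSpace ℝ E] {n : ℕ}
  [Fact (finrank ℝ E = n + 1)] {P : Type*} [TopologicalSpace P] [ChartedSpace E P]
  {ψ : sphere (0 : E) 1 × ℝ → P}

/-- **A capped side with compact side piece is compact**: it is covered by the images of the
piece `A ∖ ψ (𝕊ⁿ × (0, 1))` and of the closed unit disc (the proof of
`NeckCapData.instCompactSpaceCapped`, which assumes `P` compact only to know that the side piece
is). [folklore] -/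
theorem NeckCapData.compactSpace_of_isCompact_sidePiece (D : NeckCapData n ψ)
    (hK : IsCompact D.sidePiece) : CompactSpace D.Capped := by
  haveI : FiniteDimensional ℝ E := .of_fact_finrank_eq_succ (K := ℝ) (V := E) n
  refine D.glueData.compactSpace_of_forall_not_mem hK
    (isCompact_closedBall (0 : E) 1) (fun a ha => ?_) fun x hx => ?_
  · simp only [NeckCapData.sidePiece, mem_setOf_eq, not_not] at ha
    obtain ⟨⟨θ, t⟩, ⟨-, ht⟩, hθ⟩ := ha
    have hsrc : a ∈ D.glue.source := by
      rw [D.mem_glue_source, D.mem_glueP_source]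
      exact ⟨θ, t, ht.1, hθ⟩
    refine ⟨hsrc, ?_⟩
    change D.glue a ∈ closedBall (0 : E) 1
    rw [D.glue_apply, ← hθ, D.glueP_apply_ψ, mem_closedBall_zero_iff, norm_smul,
      mem_sphere_zero_iff_norm.1 θ.2, mul_one, Real.norm_eq_abs, abs_of_pos ht.1]
    exact ht.2.le
  · rw [mem_closedBall_zero_iff, not_le] at hx
    have hx0 : x ≠ 0 := by
      rintro rfl
      rw [norm_zero] at hx
      exact not_lt.2 zero_le_one hx
    refine ⟨D.mem_glue_target.2 hx0, ?_⟩
    change (D.glue.symm x : D.side) ∈ D.sidePiece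
    simp only [NeckCapData.sidePiece, mem_setOf_eq]
    rw [D.coe_glue_symm hx0]
    rintro ⟨⟨θ, t⟩, ⟨-, ht⟩, h⟩
    have h2 := (Prod.mk.inj (D.injective h)).2
    change t = ‖x‖ at h2
    rw [h2] at ht
    exact not_lt.2 ht.2.le hx

end CompactCriterion

/-! ### The double cap of a non-separating neck -/

namespace DoubleCap

variable {E : Type u} [NormedAddCommGroup E] [InnerProductSpace ℝ E] {n : ℕ}
  [Fact (finrank ℝ E = n + 1)]
  {Y : Type u} [TopologicalSpace Y] [T2Space Y] [ChartedSpace E Y] [IsManifold 𝓘(ℝ, E) ∞ Y]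
  {ψ : sphere (0 : E) 1 × ℝ → Y}
  (hψ : Manifold.IsSmoothEmbedding ((𝓡 n).prod 𝓘(ℝ, ℝ)) 𝓘(ℝ, E) ∞ ψ) (hψo : IsOpen (range ψ))

include hψ in
omit [T2Space Y] [IsManifold 𝓘(ℝ, E) ∞ Y] in
/-- A neck is injective. [folklore] -/
theorem injective : Injective ψ := hψ.isEmbedding.injective

include hψ hψo in
omit [T2Space Y] [IsManifold 𝓘(ℝ, E) ∞ Y] in
/-- A neck with open range is an open embedding. [folklore] -/
theorem isOpenEmbedding : IsOpenEmbedding ψ := ⟨hψ.isEmbedding, hψo⟩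

include hψ hψo in
omit [T2Space Y] [IsManifold 𝓘(ℝ, E) ∞ Y] in
/-- Images of open height windows are open. [folklore] -/
theorem isOpen_image {J : Set ℝ} (hJ : IsOpen J) : IsOpen (ψ '' (univ ×ˢ J)) :=
  (isOpenEmbedding hψ hψo).isOpenMap _ (isOpen_univ.prod hJ)

include hψ in
omit [IsManifold 𝓘(ℝ, E) ∞ Y] in
/-- Images of compact height windows are closed. [folklore] -/
theorem isClosed_image {J : Set ℝ} (hJ : IsCompact J) : IsClosed (ψ '' (univ ×ˢ J)) := by
  haveI : FiniteDimensional ℝ E := .of_fact_finrank_eq_succ (K := ℝ) (V := E) n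
  exact ((isCompact_univ.prod hJ).image hψ.isEmbedding.continuous).isClosed

/-! #### The punctured manifold `P₁ = Y ∖ ψ (𝕊ⁿ × 0)` and the first cap -/

/-- `P₁ = Y ∖ ψ (𝕊ⁿ × 0)`, an open submanifold of `Y`. [folklore] -/
def P₁ : TopologicalSpace.Opens Y :=
  ⟨(ψ '' (univ ×ˢ ({0} : Set ℝ)))ᶜ, (isClosed_image hψ isCompact_singleton).isOpen_compl⟩

omit [IsManifold 𝓘(ℝ, E) ∞ Y] in
/-- Membership in `P₁ = Y ∖ ψ (𝕊ⁿ × 0)`. [folklore] -/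
theorem mem_P₁_iff {p : Y} : p ∈ P₁ hψ ↔ p ∉ ψ '' (univ ×ˢ ({0} : Set ℝ)) := Iff.rfl

omit [IsManifold 𝓘(ℝ, E) ∞ Y] in
/-- A neck point `ψ (θ, t)` lies in `P₁` iff `t ≠ 0`. [folklore] -/
theorem apply_mem_P₁_iff {θ : sphere (0 : E) 1} {t : ℝ} : ψ (θ, t) ∈ P₁ hψ ↔ t ≠ 0 := by
  rw [mem_P₁_iff, mem_image_neck_iff (injective hψ), mem_singleton_iff]

omit [IsManifold 𝓘(ℝ, E) ∞ Y] in
/-- Points of the re-parametrised neck `ψ (θ, s + 1)`, `s ∈ (-1, 2)`, avoid `ψ (𝕊ⁿ × 0)`.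
[folklore] -/
theorem reneck_one_mem_P₁ (q : sphere (0 : E) 1 × ℝ) : reneck ψ 1 1 one_ne_zero q ∈ P₁ hψ := by
  obtain ⟨s, hs, hq, -, -⟩ := reneck_eq ψ 1 1 one_ne_zero q.1 q.2
  rw [show q = (q.1, q.2) from rfl, hq, apply_mem_P₁_iff]
  intro h
  linarith [hs.1]

/-- **The first neck** `ψ₁ (θ, t) = ψ (θ, 1 + σ t)` in `P₁`. [folklore] -/
def neckOne (q : sphere (0 : E) 1 × ℝ) : P₁ hψ := ⟨reneck ψ 1 1 one_ne_zero q, reneck_one_mem_P₁ hψ q⟩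

omit [IsManifold 𝓘(ℝ, E) ∞ Y] in
/-- The first neck, seen in `Y`, is the re-parametrised neck `reneck ψ 1 1`. [folklore] -/
@[simp] theorem coe_neckOne (q : sphere (0 : E) 1 × ℝ) :
    (neckOne hψ q : Y) = reneck ψ 1 1 one_ne_zero q := rfl

omit [IsManifold 𝓘(ℝ, E) ∞ Y] in
/-- Heights of the first neck: `ψ₁ (θ, t) = ψ (θ, s + 1)` with `s ∈ (-1, 2)`, `sign s = sign t`.
[folklore] -/
theorem neckOne_eq (θ : sphere (0 : E) 1) (t : ℝ) :
    ∃ s ∈ Ioo (-1 : ℝ) 2, (neckOne hψ (θ, t) : Y) = ψ (θ, s + 1) ∧ (0 < t ↔ 0 < s) ∧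
      (t = 0 ↔ s = 0) := by
  obtain ⟨s, hs, hq, h1, h2⟩ := reneck_eq ψ 1 1 one_ne_zero θ t
  exact ⟨s, hs, by rw [coe_neckOne, hq, one_mul], h1, h2⟩

omit [IsManifold 𝓘(ℝ, E) ∞ Y] in
/-- On `t ∈ [0, 1]` the first neck is `ψ (θ, t + 1)`. [folklore] -/
theorem coe_neckOne_of_mem_Icc (θ : sphere (0 : E) 1) {t : ℝ} (ht : t ∈ Icc (0 : ℝ) 1) :
    (neckOne hψ (θ, t) : Y) = ψ (θ, t + 1) := by
  rw [coe_neckOne, reneck_apply_of_mem_Icc ψ 1 1 one_ne_zero θ ht, one_mul]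

/-- The first neck is a smooth embedding into the open submanifold `P₁`. [folklore] -/
theorem isSmoothEmbedding_neckOne :
    Manifold.IsSmoothEmbedding ((𝓡 n).prod 𝓘(ℝ, ℝ)) 𝓘(ℝ, E) ∞ (neckOne hψ) :=
  (isSmoothEmbedding_reneck hψ 1 1 one_ne_zero).codRestrict_opens (P₁ hψ) (reneck_one_mem_P₁ hψ)

omit [IsManifold 𝓘(ℝ, E) ∞ Y] in
/-- The range of the first neck, seen in `Y`, is `ψ (𝕊ⁿ × (0, 3))`. [folklore] -/
theorem range_coe_neckOne :
    range (fun q => (neckOne hψ q : Y)) = ψ '' (univ ×ˢ Ioo (0 : ℝ) 3) := by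
  change range (reneck ψ 1 1 one_ne_zero) = _
  rw [range_reneck]
  congr 2
  ext s
  simp only [mem_image, mem_Ioo]
  constructor
  · rintro ⟨t, ⟨ht1, ht2⟩, rfl⟩; constructor <;> linarith
  · rintro ⟨h1, h2⟩; exact ⟨s - 1, ⟨by linarith, by linarith⟩, by ring⟩

include hψo in
omit [IsManifold 𝓘(ℝ, E) ∞ Y] in
/-- The first neck has open range. [folklore] -/
theorem isOpen_range_neckOne : IsOpen (range (neckOne hψ)) := by
  have : range (neckOne hψ) = Subtype.val ⁻¹' (ψ '' (univ ×ˢ Ioo (0 : ℝ) 3)) := by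
    rw [← range_coe_neckOne hψ]
    ext p
    constructor
    · rintro ⟨q, rfl⟩; exact ⟨q, rfl⟩
    · rintro ⟨q, hq⟩; exact ⟨q, Subtype.ext hq⟩
  rw [this]
  exact (isOpen_image hψ hψo isOpen_Ioo).preimage continuous_subtype_val

/-- **The first side** `A₁ = Y ∖ ψ (𝕊ⁿ × [0, 1])` (as an open subset of `P₁`). [folklore] -/
def sideOne : TopologicalSpace.Opens (P₁ hψ) :=
  ⟨{p | (p : Y) ∉ ψ '' (univ ×ˢ Icc (0 : ℝ) 1)},
    (isClosed_image hψ isCompact_Icc).isOpen_compl.preimage continuous_subtype_val⟩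

omit [IsManifold 𝓘(ℝ, E) ∞ Y] in
/-- Membership in the first side `A₁ = Y ∖ ψ (𝕊ⁿ × [0, 1])`. [folklore] -/
theorem mem_sideOne_iff {p : P₁ hψ} : p ∈ sideOne hψ ↔ (p : Y) ∉ ψ '' (univ ×ˢ Icc (0 : ℝ) 1) :=
  Iff.rfl

omit [IsManifold 𝓘(ℝ, E) ∞ Y] in
/-- A point `ψ (θ, t)` (`t ≠ 0`) of `P₁` lies in the first side iff `t ∉ [0, 1]`. [folklore] -/
theorem mk_mem_sideOne_iff {θ : sphere (0 : E) 1} {t : ℝ} (ht : ψ (θ, t) ∈ P₁ hψ) :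
    (⟨ψ (θ, t), ht⟩ : P₁ hψ) ∈ sideOne hψ ↔ t ∉ Icc (0 : ℝ) 1 := by
  rw [mem_sideOne_iff, Subtype.coe_mk, mem_image_neck_iff (injective hψ)]

/-- **The first cap datum**: `A₁` is a side of the neck `ψ₁` of `P₁`. [folklore] -/
def capOne : NeckCapData n (neckOne hψ) where
  isSmoothEmbedding := isSmoothEmbedding_neckOne hψ
  isOpen_range := isOpen_range_neckOne hψ hψo
  side := sideOne hψ
  isClosed_side_union := by
    -- the complement is `{p | ↑p ∈ ψ (𝕊ⁿ × (0, 1))}`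
    have heq : ((sideOne hψ : Set (P₁ hψ)) ∪ neckOne hψ '' (univ ×ˢ {0}))ᶜ =
        Subtype.val ⁻¹' (ψ '' (univ ×ˢ Ioo (0 : ℝ) 1)) := by
      ext ⟨p, hp⟩
      simp only [mem_compl_iff, mem_union, SetLike.mem_coe, mem_sideOne_iff, not_or, not_not,
        mem_preimage]
      constructor
      · rintro ⟨⟨⟨θ, t⟩, ⟨-, ht⟩, rfl⟩, h2⟩
        have ht0 : t ≠ 0 := (apply_mem_P₁_iff hψ).1 hp
        have ht1 : t ≠ 1 := by
          rintro rfl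
          refine h2 ⟨(θ, 0), ⟨mem_univ _, rfl⟩, Subtype.ext ?_⟩
          rw [coe_neckOne_of_mem_Icc hψ θ ⟨le_rfl, zero_le_one⟩, zero_add]
        exact ⟨(θ, t), ⟨mem_univ _, lt_of_le_of_ne ht.1 (Ne.symm ht0), lt_of_le_of_ne ht.2 ht1⟩, rfl⟩
      · rintro ⟨⟨θ, t⟩, ⟨-, ht⟩, (rfl : ψ (θ, t) = p)⟩
        refine ⟨⟨(θ, t), ⟨mem_univ _, ht.1.le, ht.2.le⟩, rfl⟩, ?_⟩
        rintro ⟨⟨θ', t'⟩, ⟨-, (rfl : t' = 0)⟩, h⟩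
        obtain ⟨s, -, hs, -, hs0⟩ := neckOne_eq hψ θ' 0
        have h' : ψ (θ', s + 1) = ψ (θ, t) := by rw [← hs]; exact congrArg Subtype.val h
        have := (Prod.mk.inj (injective hψ h')).2
        rw [hs0.1 rfl, zero_add] at this
        exact absurd this.symm (ne_of_lt ht.2)
    rw [← isOpen_compl_iff, heq]
    exact (isOpen_image hψ hψo isOpen_Ioo).preimage continuous_subtype_val
  image_Ioi_subset := by
    rintro _ ⟨⟨θ, t⟩, ⟨-, (ht : 0 < t)⟩, rfl⟩
    obtain ⟨s, -, hs, hts, -⟩ := neckOne_eq hψ θ t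
    change neckOne hψ (θ, t) ∈ sideOne hψ
    rw [mem_sideOne_iff, hs, mem_image_neck_iff (injective hψ)]
    exact fun h => absurd h.2 (not_le.2 (by linarith [hts.1 ht]))
  not_mem_side := by
    intro θ t ht h
    obtain ⟨s, hs, hse, hts, -⟩ := neckOne_eq hψ θ t
    rw [mem_sideOne_iff, hse, mem_image_neck_iff (injective hψ)] at h
    have hs0 : s ≤ 0 := not_lt.1 fun h' => absurd (hts.2 h') (not_lt.2 ht)
    exact h ⟨by linarith [hs.1], by linarith⟩

/-- The first capped manifold `Q = A₁ ∪ 𝔻`. [folklore] -/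
abbrev Q : Type u := (capOne hψ hψo).Capped

/-- `inl₁ a` lies in the first disc iff `a` is a point `ψ₁ (θ, t)`, `t > 0`, of the upper
half of the first neck. [folklore] -/
theorem inl_mem_range_inr_iff_one {a : sideOne hψ} :
    (capOne hψ hψo).glueData.inl a ∈ range (capOne hψ hψo).glueData.inr ↔
      ∃ (θ : sphere (0 : E) 1) (t : ℝ), 0 < t ∧ neckOne hψ (θ, t) = (a : P₁ hψ) := by
  rw [SmoothGlueData.inl_mem_range_inr_iff]
  exact (capOne hψ hψo).mem_glue_source.trans (capOne hψ hψo).mem_glueP_source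

omit [IsManifold 𝓘(ℝ, E) ∞ Y] in
/-- The `Y`-height of a point of the upper half of the first neck exceeds `1`. [folklore] -/
theorem exists_eq_of_neckOne_pos {θ : sphere (0 : E) 1} {t : ℝ} (ht : 0 < t) :
    ∃ s : ℝ, 1 < s ∧ (neckOne hψ (θ, t) : Y) = ψ (θ, s) := by
  obtain ⟨s, -, hs, hts, -⟩ := neckOne_eq hψ θ t
  exact ⟨s + 1, by linarith [hts.1 ht], hs⟩

/-! #### The second neck and the second cap -/

omit [IsManifold 𝓘(ℝ, E) ∞ Y] in
/-- Points of the re-parametrised neck `ψ (θ, -s - 1)`, `s ∈ (-1, 2)`, avoid `ψ (𝕊ⁿ × 0)`. [folklore] -/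
theorem reneck_neg_mem_P₁ (q : sphere (0 : E) 1 × ℝ) :
    reneck ψ (-1) (-1) (by norm_num) q ∈ P₁ hψ := by
  obtain ⟨s, hs, hq, -, -⟩ := reneck_eq ψ (-1) (-1) (by norm_num) q.1 q.2
  rw [show q = (q.1, q.2) from rfl, hq, apply_mem_P₁_iff]
  intro h
  linarith [hs.1]

/-- The second neck as a map to `P₁`: `(θ, t) ↦ ψ (θ, -1 - σ t)`. [folklore] -/
def neckTwoP (q : sphere (0 : E) 1 × ℝ) : P₁ hψ :=
  ⟨reneck ψ (-1) (-1) (by norm_num) q, reneck_neg_mem_P₁ hψ q⟩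

omit [IsManifold 𝓘(ℝ, E) ∞ Y] in
/-- Heights of the second neck: `ψ (θ, -s - 1)` with `s ∈ (-1, 2)`, `sign s = sign t`.
[folklore] -/
theorem neckTwoP_eq (θ : sphere (0 : E) 1) (t : ℝ) :
    ∃ s ∈ Ioo (-1 : ℝ) 2, (neckTwoP hψ (θ, t) : Y) = ψ (θ, -s - 1) ∧ (0 < t ↔ 0 < s) ∧
      (t = 0 ↔ s = 0) := by
  obtain ⟨s, hs, hq, h1, h2⟩ := reneck_eq ψ (-1) (-1) (by norm_num) θ t
  refine ⟨s, hs, ?_, h1, h2⟩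
  change reneck ψ (-1) (-1) _ (θ, t) = _
  rw [hq]; congr 1; ext <;> simp; ring

omit [IsManifold 𝓘(ℝ, E) ∞ Y] in
/-- On `t ∈ [0, 1]` the second neck is `ψ (θ, -t - 1)`. [folklore] -/
theorem coe_neckTwoP_of_mem_Icc (θ : sphere (0 : E) 1) {t : ℝ} (ht : t ∈ Icc (0 : ℝ) 1) :
    (neckTwoP hψ (θ, t) : Y) = ψ (θ, -t - 1) := by
  change reneck ψ (-1) (-1) _ (θ, t) = _
  rw [reneck_apply_of_mem_Icc ψ (-1) (-1) _ θ ht]; congr 1; ext <;> simp; ring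

omit [IsManifold 𝓘(ℝ, E) ∞ Y] in
/-- The second neck lies in the first side (its heights are negative). [folklore] -/
theorem neckTwoP_mem_sideOne (q : sphere (0 : E) 1 × ℝ) : neckTwoP hψ q ∈ sideOne hψ := by
  obtain ⟨s, hs, hq, -, -⟩ := neckTwoP_eq hψ q.1 q.2
  rw [show q = (q.1, q.2) from rfl, mem_sideOne_iff, hq, mem_image_neck_iff (injective hψ)]
  exact fun h => by linarith [h.1, hs.1]

/-- The second neck is a smooth embedding into `P₁`. [folklore] -/
theorem isSmoothEmbedding_neckTwoP :
    Manifold.IsSmoothEmbedding ((𝓡 n).prod 𝓘(ℝ, ℝ)) 𝓘(ℝ, E) ∞ (neckTwoP hψ) :=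
  (isSmoothEmbedding_reneck hψ (-1) (-1) (by norm_num)).codRestrict_opens (P₁ hψ)
    (reneck_neg_mem_P₁ hψ)

omit [IsManifold 𝓘(ℝ, E) ∞ Y] in
/-- The range of the second neck, seen in `Y`, is `ψ (𝕊ⁿ × (-3, 0))`. [folklore] -/
theorem range_coe_neckTwoP :
    range (fun q => (neckTwoP hψ q : Y)) = ψ '' (univ ×ˢ Ioo (-3 : ℝ) 0) := by
  change range (reneck ψ (-1) (-1) _) = _
  rw [range_reneck]
  congr 2
  ext s
  simp only [mem_image, mem_Ioo]
  constructor
  · rintro ⟨t, ⟨ht1, ht2⟩, rfl⟩; constructor <;> linarith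
  · rintro ⟨h1, h2⟩; exact ⟨-s - 1, ⟨by linarith, by linarith⟩, by ring⟩

include hψo in
omit [IsManifold 𝓘(ℝ, E) ∞ Y] in
/-- The second neck has open range in `P₁`. [folklore] -/
theorem isOpen_range_neckTwoP : IsOpen (range (neckTwoP hψ)) := by
  have : range (neckTwoP hψ) = Subtype.val ⁻¹' (ψ '' (univ ×ˢ Ioo (-3 : ℝ) 0)) := by
    rw [← range_coe_neckTwoP hψ]
    ext p
    constructor
    · rintro ⟨q, rfl⟩; exact ⟨q, rfl⟩
    · rintro ⟨q, hq⟩; exact ⟨q, Subtype.ext hq⟩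
  rw [this]
  exact (isOpen_image hψ hψo isOpen_Ioo).preimage continuous_subtype_val

/-- **The second neck** `ψ₂ = inl₁ ∘ (θ, t) ↦ ψ (θ, -1 - σ t)` in `Q`. [folklore] -/
def neckTwo : sphere (0 : E) 1 × ℝ → Q hψ hψo :=
  (capOne hψ hψo).liftMap (neckTwoP hψ) (neckTwoP_mem_sideOne hψ)

/-- Unfolding of the second neck: `inl₁` of the second neck in `P₁`. [folklore] -/
theorem neckTwo_apply (q : sphere (0 : E) 1 × ℝ) :
    neckTwo hψ hψo q = (capOne hψ hψo).glueData.inl ⟨neckTwoP hψ q, neckTwoP_mem_sideOne hψ q⟩ :=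
  rfl

/-- The second neck is a smooth embedding into `Q`. [folklore] -/
theorem isSmoothEmbedding_neckTwo :
    Manifold.IsSmoothEmbedding ((𝓡 n).prod 𝓘(ℝ, ℝ)) 𝓘(ℝ, E) ∞ (neckTwo hψ hψo) :=
  (capOne hψ hψo).isSmoothEmbedding_liftMap (isSmoothEmbedding_neckTwoP hψ) _

/-- The second neck has open range in `Q`. [folklore] -/
theorem isOpen_range_neckTwo : IsOpen (range (neckTwo hψ hψo)) :=
  (capOne hψ hψo).isOpen_range_liftMap (isOpen_range_neckTwoP hψ hψo) _

/-- The far part `U' = Y ∖ ψ (𝕊ⁿ × [-1, 1])` of `Y`, seen in `P₁`. [folklore] -/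
def farSet : Set (P₁ hψ) := {p | (p : Y) ∉ ψ '' (univ ×ˢ Icc (-1 : ℝ) 1)}

omit [IsManifold 𝓘(ℝ, E) ∞ Y] in
/-- The far set is open. [folklore] -/
theorem isOpen_farSet : IsOpen (farSet hψ) :=
  (isClosed_image hψ isCompact_Icc).isOpen_compl.preimage continuous_subtype_val

omit [IsManifold 𝓘(ℝ, E) ∞ Y] in
/-- The far set lies in the first side. [folklore] -/
theorem farSet_subset_sideOne : farSet hψ ⊆ (sideOne hψ : Set (P₁ hψ)) := fun p hp h =>
  hp (image_neck_mono ψ (Icc_subset_Icc (by norm_num) le_rfl) h)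

/-- **The second side** `A₂ = inl₁ (U') ∪ (first disc)`, an open subset of `Q`. [folklore] -/
def sideTwo : TopologicalSpace.Opens (Q hψ hψo) :=
  ⟨(capOne hψ hψo).inlSet (farSet hψ) ∪ range (capOne hψ hψo).glueData.inr,
    ((capOne hψ hψo).isOpen_inlSet (isOpen_farSet hψ)).union
      (capOne hψ hψo).glueData.isOpen_range_inr⟩

/-- Membership in the second side. [folklore] -/
theorem mem_sideTwo_iff {p : Q hψ hψo} :
    p ∈ sideTwo hψ hψo ↔ p ∈ (capOne hψ hψo).inlSet (farSet hψ) ∨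
      p ∈ range (capOne hψ hψo).glueData.inr :=
  Iff.rfl

/-- `inl₁ a ∈ A₂` iff the `Y`-height of `a` is outside `[-1, 1]` or `a` is on the upper half
of the first neck. [folklore] -/
theorem inl_mem_sideTwo_iff {a : sideOne hψ} :
    (capOne hψ hψo).glueData.inl a ∈ sideTwo hψ hψo ↔
      ((a : P₁ hψ) : Y) ∉ ψ '' (univ ×ˢ Icc (-1 : ℝ) 1) ∨
        ∃ (θ : sphere (0 : E) 1) (t : ℝ), 0 < t ∧ neckOne hψ (θ, t) = (a : P₁ hψ) := by
  rw [mem_sideTwo_iff, NeckCapData.inl_mem_inlSet_iff, inl_mem_range_inr_iff_one]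
  rfl

/-- The second neck misses the first disc. [folklore] -/
theorem neckTwo_notMem_range_inr (q : sphere (0 : E) 1 × ℝ) :
    neckTwo hψ hψo q ∉ range (capOne hψ hψo).glueData.inr := by
  rw [neckTwo_apply, inl_mem_range_inr_iff_one]
  rintro ⟨θ, t, ht, h⟩
  obtain ⟨s, hs1, hs⟩ := exists_eq_of_neckOne_pos hψ (θ := θ) ht
  obtain ⟨s', hs', hq, -, -⟩ := neckTwoP_eq hψ q.1 q.2
  have h' : ψ (θ, s) = ψ (q.1, -s' - 1) := by
    rw [← hs, ← hq, show (q.1, q.2) = q from rfl]; exact congrArg Subtype.val h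
  have := (Prod.mk.inj (injective hψ h')).2
  linarith [hs'.1]

/-- **The second cap datum**: `A₂` is a side of the neck `ψ₂` of `Q`. [folklore] -/
def capTwo : NeckCapData n (neckTwo hψ hψo) where
  isSmoothEmbedding := isSmoothEmbedding_neckTwo hψ hψo
  isOpen_range := isOpen_range_neckTwo hψ hψo
  side := sideTwo hψ hψo
  isClosed_side_union := by
    set D := capOne hψ hψo with hD
    have heq : ((sideTwo hψ hψo : Set (Q hψ hψo)) ∪ neckTwo hψ hψo '' (univ ×ˢ {0}))ᶜ =
        D.inlSet {p : P₁ hψ | (p : Y) ∈ ψ '' (univ ×ˢ Ioo (-1 : ℝ) 0)} := by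
      ext p
      simp only [mem_compl_iff, mem_union, SetLike.mem_coe, not_or]
      constructor
      · rintro ⟨h1, h2⟩
        rcases D.glueData.exists_inl_or_inr p with ⟨a, rfl⟩ | ⟨x, rfl⟩
        · rw [inl_mem_sideTwo_iff, not_or] at h1
          obtain ⟨h1a, h1b⟩ := h1
          rw [not_not] at h1a
          obtain ⟨⟨θ, ℓ⟩, ⟨-, hℓ⟩, hθ⟩ := h1a
          rw [NeckCapData.inl_mem_inlSet_iff, mem_setOf_eq, ← hθ, mem_image_neck_iff (injective hψ)]
          have hℓ0 : ℓ ∉ Icc (0 : ℝ) 1 := fun h => a.2 (by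
            rw [← hθ]; exact (mem_image_neck_iff (injective hψ)).2 h)
          have hℓ1 : ℓ ≠ -1 := by
            rintro rfl
            refine h2 ⟨(θ, 0), ⟨mem_univ _, rfl⟩, ?_⟩
            rw [neckTwo_apply]
            congr 1
            apply Subtype.ext; apply Subtype.ext
            rw [coe_neckTwoP_of_mem_Icc hψ θ ⟨le_rfl, zero_le_one⟩, ← hθ]
            norm_num
          refine ⟨lt_of_le_of_ne hℓ.1 (Ne.symm hℓ1), lt_of_not_ge fun h => hℓ0 ⟨h, hℓ.2⟩⟩
        · exact absurd (Or.inr (mem_range_self x)) h1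
      · rintro ⟨a, ha, rfl⟩
        obtain ⟨⟨θ, ℓ⟩, ⟨-, hℓ⟩, hθ⟩ := ha
        refine ⟨?_, ?_⟩
        · rw [inl_mem_sideTwo_iff, not_or, not_not, ← hθ, mem_image_neck_iff (injective hψ)]
          refine ⟨⟨by linarith [hℓ.1], by linarith [hℓ.2]⟩, ?_⟩
          rintro ⟨θ', t', ht', h'⟩
          obtain ⟨s, hs1, hs⟩ := exists_eq_of_neckOne_pos hψ (θ := θ') ht'
          have h'' : ψ (θ', s) = ψ (θ, ℓ) := by rw [← hs, h', hθ]
          have := (Prod.mk.inj (injective hψ h'')).2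
          linarith [hℓ.2]
        · rintro ⟨⟨θ', t'⟩, ⟨-, (rfl : t' = 0)⟩, h'⟩
          rw [neckTwo_apply] at h'
          have h'' := congrArg (fun b : sideOne hψ => ((b : P₁ hψ) : Y)) (D.glueData.inl_injective h')
          simp only at h''
          rw [coe_neckTwoP_of_mem_Icc hψ θ' ⟨le_rfl, zero_le_one⟩, ← hθ] at h''
          have := (Prod.mk.inj (injective hψ h'')).2
          linarith [hℓ.1]
    rw [← isOpen_compl_iff, heq]
    exact D.isOpen_inlSet ((isOpen_image hψ hψo isOpen_Ioo).preimage continuous_subtype_val)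
  image_Ioi_subset := by
    rintro _ ⟨⟨θ, t⟩, ⟨-, (ht : 0 < t)⟩, rfl⟩
    change neckTwo hψ hψo (θ, t) ∈ sideTwo hψ hψo
    rw [neckTwo_apply, inl_mem_sideTwo_iff]
    obtain ⟨s, -, hs, hts, -⟩ := neckTwoP_eq hψ θ t
    refine Or.inl ?_
    rw [Subtype.coe_mk, hs, mem_image_neck_iff (injective hψ)]
    exact fun h => by linarith [h.1, hts.1 ht]
  not_mem_side := by
    intro θ t ht h
    change neckTwo hψ hψo (θ, t) ∈ sideTwo hψ hψo at h
    rw [neckTwo_apply, inl_mem_sideTwo_iff] at h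
    obtain ⟨s, hs, hse, hts, -⟩ := neckTwoP_eq hψ θ t
    have hs0 : s ≤ 0 := not_lt.1 fun h' => absurd (hts.2 h') (not_lt.2 ht)
    rcases h with h | ⟨θ', t', ht', h'⟩
    · rw [Subtype.coe_mk, hse, mem_image_neck_iff (injective hψ)] at h
      exact h ⟨by linarith, by linarith [hs.1]⟩
    · obtain ⟨s', hs1, hs'⟩ := exists_eq_of_neckOne_pos hψ (θ := θ') ht'
      have h'' : ψ (θ', s') = ψ (θ, -s - 1) := by rw [← hs', h', Subtype.coe_mk, hse]
      have := (Prod.mk.inj (injective hψ h'')).2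
      linarith [hs.1]

/-- **The double cap** `M = A₂ ∪ 𝔻`: `Y` cut along the non-separating sphere `ψ (𝕊ⁿ × 0)` with
both boundary spheres capped off. [folklore] -/
abbrev M : Type u := (capTwo hψ hψo).Capped

omit [IsManifold 𝓘(ℝ, E) ∞ Y] in
/-- Exact heights of the first neck. [folklore] -/
theorem coe_neckOne_apply (θ : sphere (0 : E) 1) (t : ℝ) :
    (neckOne hψ (θ, t) : Y) = ψ (θ, intervalStretch 2 t + 1) := by
  rw [coe_neckOne, reneck_apply, one_mul]

/-! #### Compactness -/

/-- The side piece of the second cap is compact when `Y` is: it lies in the union of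
`inl₁ (Y ∖ ψ (𝕊ⁿ × (-2, 3/2)))` and the closed first disc. [folklore] -/
theorem isCompact_sidePiece_capTwo [CompactSpace Y] : IsCompact (capTwo hψ hψo).sidePiece := by
  haveI : FiniteDimensional ℝ E := .of_fact_finrank_eq_succ (K := ℝ) (V := E) n
  set D₁ := capOne hψ hψo with hD₁
  set K₁ : Set (sideOne hψ) := {a | ((a : P₁ hψ) : Y) ∉ ψ '' (univ ×ˢ Ioo (-2 : ℝ) (3 / 2))}
    with hK₁def
  have hK₁ : IsCompact K₁ := by
    have hemb : IsEmbedding (fun a : sideOne hψ => ((a : P₁ hψ) : Y)) :=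
      IsEmbedding.subtypeVal.comp IsEmbedding.subtypeVal
    rw [hemb.isCompact_iff]
    have heq : (fun a : sideOne hψ => ((a : P₁ hψ) : Y)) '' K₁ =
        (ψ '' (univ ×ˢ Ioo (-2 : ℝ) (3 / 2)))ᶜ := by
      ext y
      constructor
      · rintro ⟨a, ha, rfl⟩; exact ha
      · intro hy
        have hy1 : y ∈ P₁ hψ := fun h =>
          hy (image_neck_mono ψ (show ({0} : Set ℝ) ⊆ Ioo (-2 : ℝ) (3 / 2) from
            singleton_subset_iff.2 ⟨by norm_num, by norm_num⟩) h)
        have hy2 : (⟨y, hy1⟩ : P₁ hψ) ∈ sideOne hψ := fun h =>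
          hy (image_neck_mono ψ (Icc_subset_Ioo (by norm_num) (by norm_num)) h)
        exact ⟨⟨⟨y, hy1⟩, hy2⟩, hy, rfl⟩
    rw [heq]
    exact (isOpen_image hψ hψo isOpen_Ioo).isClosed_compl.isCompact
  -- the compact `K ⊆ Q`, contained in the second side
  set K : Set (Q hψ hψo) := D₁.glueData.inl '' K₁ ∪ D₁.glueData.inr '' closedBall 0 1 with hKdef
  have hK : IsCompact K :=
    (hK₁.image D₁.glueData.continuous_inl).union
      ((isCompact_closedBall (0 : E) 1).image D₁.glueData.continuous_inr)
  have hKside : K ⊆ (sideTwo hψ hψo : Set (Q hψ hψo)) := by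
    rintro p (⟨a, ha, rfl⟩ | ⟨x, -, rfl⟩)
    · refine Or.inl ((NeckCapData.inl_mem_inlSet_iff _).2 fun h => ha ?_)
      exact image_neck_mono ψ (Icc_subset_Ioo (by norm_num) (by norm_num)) h
    · exact Or.inr (mem_range_self x)
  have hKA : IsCompact ((Subtype.val : sideTwo hψ hψo → Q hψ hψo) ⁻¹' K) := by
    rw [IsEmbedding.subtypeVal.isCompact_iff, image_preimage_eq_of_subset]
    · exact hK
    · rw [Subtype.range_coe]; exact hKside
  -- the side piece is closed
  have hcl : IsClosed (capTwo hψ hψo).sidePiece :=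
    ((capTwo hψ hψo).isOpenEmbedding.isOpenMap _ (isOpen_univ.prod isOpen_Ioo)).isClosed_compl.preimage
      continuous_subtype_val
  refine hKA.of_isClosed_subset hcl fun b hb => ?_
  -- the side piece lies in `K`
  rw [mem_preimage]
  have hb2 : (b : Q hψ hψo) ∈ sideTwo hψ hψo := b.2
  rcases hb2 with ⟨a, ha, hab⟩ | ⟨x, hx⟩
  · by_cases h : ((a : P₁ hψ) : Y) ∈ ψ '' (univ ×ˢ Ioo (-2 : ℝ) (3 / 2))
    · obtain ⟨⟨θ, ℓ⟩, ⟨-, hℓ⟩, hθ⟩ := h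
      have hℓ' : ℓ ∉ Icc (-1 : ℝ) 1 := fun h' => ha (by
        rw [← hθ]; exact (mem_image_neck_iff (injective hψ)).2 h')
      rcases lt_or_gt_of_ne (show ℓ ≠ 0 by rintro rfl; exact hℓ' ⟨by norm_num, by norm_num⟩) with hℓ0 | hℓ0
      · -- `ℓ ∈ (-2, -1)`: then `b` is on the collar `ψ₂ (𝕊ⁿ × (0, 1))`, excluded
        have hℓ1 : ℓ < -1 := lt_of_not_ge fun h' => hℓ' ⟨h', by linarith⟩
        exfalso
        refine hb ⟨(θ, -ℓ - 1), ⟨mem_univ _, by constructor <;> linarith [hℓ.1]⟩, ?_⟩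
        rw [← hab, neckTwo_apply]
        congr 1
        apply Subtype.ext; apply Subtype.ext
        rw [coe_neckTwoP_of_mem_Icc hψ θ ⟨by linarith, by linarith [hℓ.1]⟩, ← hθ]
        congr 1; ext <;> simp
      · -- `ℓ ∈ (1, 3/2)`: then `inl₁ a` is in the closed first disc
        have hℓ1 : 1 < ℓ := lt_of_not_ge fun h' => hℓ' ⟨by linarith, h'⟩
        have ha' : a = ⟨neckOne hψ (θ, ℓ - 1), D₁.mem_side θ (by linarith)⟩ := by
          apply Subtype.ext; apply Subtype.ext
          rw [← hθ]
          change ψ (θ, ℓ) = (neckOne hψ (θ, ℓ - 1) : Y)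
          rw [coe_neckOne_of_mem_Icc hψ θ ⟨by linarith, by linarith [hℓ.2]⟩, sub_add_cancel]
        refine Or.inr ⟨(ℓ - 1) • (θ : E), ?_, ?_⟩
        · rw [mem_closedBall_zero_iff, norm_smul, mem_sphere_zero_iff_norm.1 θ.2, mul_one,
            Real.norm_eq_abs, abs_of_pos (by linarith)]
          linarith [hℓ.2]
        · rw [← hab, ha', D₁.inl_eq_inr θ (by linarith)]
    · exact Or.inl ⟨a, h, hab⟩
  · by_cases hx1 : ‖x‖ ≤ 1
    · exact Or.inr ⟨x, mem_closedBall_zero_iff.2 hx1, hx⟩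
    · rw [not_le] at hx1
      have hx0 : x ≠ 0 := by
        rintro rfl; rw [norm_zero] at hx1; exact not_lt.2 zero_le_one hx1
      refine Or.inl ⟨D₁.glue.symm x, ?_, ?_⟩
      · -- the height of `glue.symm x = ψ₁ (x/‖x‖, ‖x‖)` is `σ ‖x‖ + 1 ∈ (2, 3)`
        change ((D₁.glue.symm x : sideOne hψ) : P₁ hψ).1 ∉ _
        rw [D₁.coe_glue_symm hx0]
        change (neckOne hψ (unitDir (unitSpherePoint n) x, ‖x‖) : Y) ∉ _
        rw [coe_neckOne_apply, mem_image_neck_iff (injective hψ)]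
        have h1 : intervalStretch 2 1 < intervalStretch 2 ‖x‖ :=
          strictMono_intervalStretch one_lt_two hx1
        rw [intervalStretch_of_mem_Icc one_lt_two ⟨zero_le_one, le_rfl⟩] at h1
        exact fun h => by linarith [h.2]
      · rw [← hx]
        exact D₁.glueData.inl_glue_symm (D₁.mem_glue_target.2 hx0)

/-- **The double cap of a compact manifold is compact.** [folklore] -/
theorem compactSpace [CompactSpace Y] : CompactSpace (M hψ hψo) :=
  (capTwo hψ hψo).compactSpace_of_isCompact_sidePiece (isCompact_sidePiece_capTwo hψ hψo)

/-- The double cap of a compact manifold is second countable. [folklore] -/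
theorem secondCountableTopology [CompactSpace Y] : SecondCountableTopology (M hψ hψo) := by
  haveI : FiniteDimensional ℝ E := .of_fact_finrank_eq_succ (K := ℝ) (V := E) n
  haveI := compactSpace hψ hψo
  exact (capTwo hψ hψo).glueData.secondCountableTopology

/-! #### Orientability -/

/-- **The double cap of an orientable manifold is orientable** (`n ≠ 0`). [folklore] -/
theorem isOrientable (hY : IsOrientable 𝓘(ℝ, E) Y) (hn : n ≠ 0) :
    IsOrientable 𝓘(ℝ, E) (M hψ hψo) :=
  (capTwo hψ hψo).isOrientable_capped ((capOne hψ hψo).isOrientable_capped (hY.opens _) hn) hn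

/-! #### Connectedness -/

omit [T2Space Y] [IsManifold 𝓘(ℝ, E) ∞ Y] in
include hψ in
/-- Rerouting lemma for the cover argument: if `C` is preconnected, covered by
`(w ∪ A) ∪ (w' ∪ B)` with the four sets open and pairwise separated as stated, and
`U ⊆ C` meets `A`, `B` only inside `w`, `w'` respectively, then `U ⊆ w` or `U ⊆ w'`. [folklore] -/
theorem subset_or_subset_of_cover {C U w w' A B : Set Y} (hC : IsPreconnected C)
    (hw : IsOpen w) (hw' : IsOpen w') (hA : IsOpen A) (hB : IsOpen B)
    (hww' : Disjoint w w') (hwB : Disjoint w B) (hAw' : Disjoint A w') (hAB : Disjoint A B)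
    (hcov : C ⊆ (w ∪ A) ∪ (w' ∪ B)) (hUC : U ⊆ C) (hUA : U ∩ A ⊆ w) (hUB : U ∩ B ⊆ w') :
    U ⊆ w ∨ U ⊆ w' := by
  have _ := hψ
  have hdisj : Disjoint (w ∪ A) (w' ∪ B) :=
    Disjoint.union_left (Disjoint.union_right hww' hwB) (Disjoint.union_right hAw' hAB)
  rcases hC.subset_or_subset (hw.union hA) (hw'.union hB) hdisj hcov with h | h
  · exact Or.inl fun x hx => (h (hUC hx)).elim id fun hxA => hUA ⟨hx, hxA⟩
  · exact Or.inr fun x hx => (h (hUC hx)).elim id fun hxB => hUB ⟨hx, hxB⟩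

omit [IsManifold 𝓘(ℝ, E) ∞ Y] in
include hψ hψo in
/-- **`Y ∖ ψ (𝕊ⁿ × [-1, 1])` is connected when `Y ∖ ψ (𝕊ⁿ × 0)` is** (`n ≠ 0`).  Given a
separation `u ⊔ v` of `U' = Y ∖ ψ (𝕊ⁿ × [-1, 1])`, the connected collars `ψ (𝕊ⁿ × (1, 2))`,
`ψ (𝕊ⁿ × (-2, -1)) ⊆ U'` each lie in `u` or in `v`; attaching the tubes `ψ (𝕊ⁿ × (0, 2))`,
`ψ (𝕊ⁿ × (-2, 0))` accordingly gives a separation of `Y ∖ ψ (𝕊ⁿ × 0)`. [folklore] -/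
theorem isPreconnected_compl_image_Icc (hn : n ≠ 0)
    (hns : IsPreconnected (ψ '' (univ ×ˢ ({0} : Set ℝ)))ᶜ) :
    IsPreconnected (ψ '' (univ ×ˢ Icc (-1 : ℝ) 1))ᶜ := by
  haveI : FiniteDimensional ℝ E := .of_fact_finrank_eq_succ (K := ℝ) (V := E) n
  haveI : ConnectedSpace (sphere (0 : E) 1) := by
    have h1 : 1 < Module.rank ℝ E := by
      rw [← Module.finrank_eq_rank, (Fact.out : finrank ℝ E = n + 1)]
      exact_mod_cast (by omega : 1 < n + 1)
    exact isConnected_iff_connectedSpace.1 (isConnected_sphere h1 (0 : E) zero_le_one)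
  have hinj := injective hψ
  have hcont : Continuous ψ := hψ.isEmbedding.continuous
  set C := (ψ '' (univ ×ˢ ({0} : Set ℝ)))ᶜ with hCdef
  set U := (ψ '' (univ ×ˢ Icc (-1 : ℝ) 1))ᶜ with hUdef
  set Tp := ψ '' (univ ×ˢ Ioo (0 : ℝ) 2) with hTp
  set Tm := ψ '' (univ ×ˢ Ioo (-2 : ℝ) 0) with hTm
  set Kp := ψ '' (univ ×ˢ Ioo (1 : ℝ) 2) with hKp
  set Km := ψ '' (univ ×ˢ Ioo (-2 : ℝ) (-1)) with hKm
  have hUo : IsOpen U := (isClosed_image hψ isCompact_Icc).isOpen_compl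
  have hTpo : IsOpen Tp := isOpen_image hψ hψo isOpen_Ioo
  have hTmo : IsOpen Tm := isOpen_image hψ hψo isOpen_Ioo
  have hpre : ∀ a b : ℝ, IsPreconnected (ψ '' (univ ×ˢ Ioo a b)) := fun a b =>
    (isPreconnected_univ.prod isPreconnected_Ioo).image _ hcont.continuousOn
  have hKpU : Kp ⊆ U := by
    rintro _ ⟨⟨θ, t⟩, ⟨-, ht⟩, rfl⟩ h
    exact absurd ((mem_image_neck_iff hinj).1 h).2 (not_le.2 ht.1)
  have hKmU : Km ⊆ U := by
    rintro _ ⟨⟨θ, t⟩, ⟨-, ht⟩, rfl⟩ h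
    exact absurd ((mem_image_neck_iff hinj).1 h).1 (not_le.2 ht.2)
  have hUTp : U ∩ Tp ⊆ Kp := by
    rintro _ ⟨hU', ⟨⟨θ, t⟩, ⟨-, ht⟩, rfl⟩⟩
    rw [hUdef, mem_compl_iff, mem_image_neck_iff hinj] at hU'
    exact (mem_image_neck_iff hinj).2 ⟨lt_of_not_ge fun h => hU' ⟨by linarith [ht.1], h⟩, ht.2⟩
  have hUTm : U ∩ Tm ⊆ Km := by
    rintro _ ⟨hU', ⟨⟨θ, t⟩, ⟨-, ht⟩, rfl⟩⟩
    rw [hUdef, mem_compl_iff, mem_image_neck_iff hinj] at hU'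
    exact (mem_image_neck_iff hinj).2 ⟨ht.1, lt_of_not_ge fun h => hU' ⟨h, by linarith [ht.2]⟩⟩
  have hTT : Disjoint Tp Tm := disjoint_image_neck hinj (by
    rw [Set.disjoint_left]; rintro t ⟨h1, -⟩ ⟨-, h2⟩; linarith)
  have hUC : U ⊆ C := compl_subset_compl.2 (image_neck_mono ψ (by
    rw [singleton_subset_iff]; exact ⟨by norm_num, by norm_num⟩))
  have hCcov : C ⊆ U ∪ Tp ∪ Tm := by
    intro y hy
    by_cases hyU : y ∈ U
    · exact Or.inl (Or.inl hyU)
    rw [hUdef, mem_compl_iff, not_not] at hyU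
    obtain ⟨⟨θ, t⟩, ⟨-, ht⟩, rfl⟩ := hyU
    have ht0 : t ≠ 0 := fun h => hy ((mem_image_neck_iff hinj).2 h)
    rcases lt_or_gt_of_ne ht0 with h | h
    · exact Or.inr ((mem_image_neck_iff hinj).2 ⟨by linarith [ht.1], h⟩)
    · exact Or.inl (Or.inr ((mem_image_neck_iff hinj).2 ⟨h, by linarith [ht.2]⟩))
  obtain ⟨θ₀⟩ : Nonempty (sphere (0 : E) 1) := ⟨unitSpherePoint n⟩
  have hKpne : (ψ (θ₀, 3 / 2)) ∈ Kp := (mem_image_neck_iff hinj).2 ⟨by norm_num, by norm_num⟩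
  have hKmne : (ψ (θ₀, -3 / 2)) ∈ Km := (mem_image_neck_iff hinj).2 ⟨by norm_num, by norm_num⟩
  rw [isPreconnected_iff_subset_of_disjoint]
  intro u v hu hv hUuv huv
  -- shrink `u`, `v` into `U`
  set w := u ∩ U with hw
  set w' := v ∩ U with hw'
  have hwo : IsOpen w := hu.inter hUo
  have hw'o : IsOpen w' := hv.inter hUo
  have hww' : Disjoint w w' := by
    rw [Set.disjoint_left]
    rintro x ⟨hxu, hxU⟩ ⟨hxv, -⟩
    have : x ∈ U ∩ (u ∩ v) := ⟨hxU, hxu, hxv⟩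
    rw [huv] at this
    exact this
  have hUww' : U ⊆ w ∪ w' := fun x hx => (hUuv hx).imp (fun h => ⟨h, hx⟩) fun h => ⟨h, hx⟩
  have hwU : w ⊆ U := inter_subset_right
  have hw'U : w' ⊆ U := inter_subset_right
  -- the collars choose sides
  have hKp : Kp ⊆ w ∨ Kp ⊆ w' := (hpre 1 2).subset_or_subset hwo hw'o hww' (hKpU.trans hUww')
  have hKm : Km ⊆ w ∨ Km ⊆ w' := (hpre (-2) (-1)).subset_or_subset hwo hw'o hww' (hKmU.trans hUww')
  -- separation facts for attaching the tubes
  have hTp_of : ∀ {a b : Set Y}, Disjoint a b → b ⊆ U → Kp ⊆ a → Disjoint Tp b := by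
    intro a b hab hbU hKa
    rw [Set.disjoint_left]
    intro x hxT hxb
    exact Set.disjoint_left.1 hab (hKa (hUTp ⟨hbU hxb, hxT⟩)) hxb
  have hTm_of : ∀ {a b : Set Y}, Disjoint a b → b ⊆ U → Km ⊆ a → Disjoint Tm b := by
    intro a b hab hbU hKa
    rw [Set.disjoint_left]
    intro x hxT hxb
    exact Set.disjoint_left.1 hab (hKa (hUTm ⟨hbU hxb, hxT⟩)) hxb
  have hUTp' : ∀ {a : Set Y}, Kp ⊆ a → U ∩ Tp ⊆ a := fun h x hx => h (hUTp hx)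
  have hUTm' : ∀ {a : Set Y}, Km ⊆ a → U ∩ Tm ⊆ a := fun h x hx => h (hUTm hx)
  have key : U ⊆ w ∨ U ⊆ w' := by
    rcases hKp with hp | hp <;> rcases hKm with hm | hm
    · -- both tubes go with `w`
      refine subset_or_subset_of_cover hψ (A := Tp ∪ Tm) (B := ∅) hns hwo hw'o (hTpo.union hTmo)
        isOpen_empty hww' (disjoint_empty _) ?_ (disjoint_empty _) ?_ hUC ?_ (by simp)
      · exact Disjoint.union_left (hTp_of hww' hw'U hp) (hTm_of hww' hw'U hm)
      · intro y hy
        rcases hCcov hy with (h | h) | h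
        · exact (hUww' h).imp (fun h => Or.inl h) fun h => Or.inl h
        · exact Or.inl (Or.inr (Or.inl h))
        · exact Or.inl (Or.inr (Or.inr h))
      · rintro x ⟨hxU, hxA | hxA⟩
        · exact hUTp' hp ⟨hxU, hxA⟩
        · exact hUTm' hm ⟨hxU, hxA⟩
    · refine subset_or_subset_of_cover hψ (A := Tp) (B := Tm) hns hwo hw'o hTpo hTmo hww'
        (hTm_of hww'.symm hwU hm).symm (hTp_of hww' hw'U hp) hTT ?_ hUC (hUTp' hp) (hUTm' hm)
      intro y hy
      rcases hCcov hy with (h | h) | h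
      · exact (hUww' h).imp (fun h => Or.inl h) fun h => Or.inl h
      · exact Or.inl (Or.inr h)
      · exact Or.inr (Or.inr h)
    · refine subset_or_subset_of_cover hψ (A := Tm) (B := Tp) hns hwo hw'o hTmo hTpo hww'
        (hTp_of hww'.symm hwU hp).symm (hTm_of hww' hw'U hm) hTT.symm ?_ hUC (hUTm' hm) (hUTp' hp)
      intro y hy
      rcases hCcov hy with (h | h) | h
      · exact (hUww' h).imp (fun h => Or.inl h) fun h => Or.inl h
      · exact Or.inr (Or.inr h)
      · exact Or.inl (Or.inr h)
    · -- both tubes go with `w'`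
      refine subset_or_subset_of_cover hψ (A := ∅) (B := Tp ∪ Tm) hns hwo hw'o isOpen_empty
        (hTpo.union hTmo) hww' ?_ (empty_disjoint _) (empty_disjoint _) ?_ hUC (by simp) ?_
      · exact Disjoint.union_right (hTp_of hww'.symm hwU hp).symm (hTm_of hww'.symm hwU hm).symm
      · intro y hy
        rcases hCcov hy with (h | h) | h
        · exact (hUww' h).imp (fun h => Or.inl h) fun h => Or.inl h
        · exact Or.inr (Or.inr (Or.inl h))
        · exact Or.inr (Or.inr (Or.inr h))
      · rintro x ⟨hxU, hxB | hxB⟩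
        · exact hUTp' hp ⟨hxU, hxB⟩
        · exact hUTm' hm ⟨hxU, hxB⟩
  exact key.imp (fun h => h.trans inter_subset_left) fun h => h.trans inter_subset_left

omit [IsManifold 𝓘(ℝ, E) ∞ Y] in
include hψo in
/-- The far set `U' ⊆ P₁` is connected when `Y ∖ ψ (𝕊ⁿ × 0)` is (`n ≠ 0`). [folklore] -/
theorem isConnected_farSet (hn : n ≠ 0) (hns : IsPreconnected (ψ '' (univ ×ˢ ({0} : Set ℝ)))ᶜ) :
    IsConnected (farSet hψ) := by
  haveI : FiniteDimensional ℝ E := .of_fact_finrank_eq_succ (K := ℝ) (V := E) n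
  obtain ⟨θ₀⟩ : Nonempty (sphere (0 : E) 1) := ⟨unitSpherePoint n⟩
  have hmem : ψ (θ₀, 2) ∈ P₁ hψ := (apply_mem_P₁_iff hψ).2 (by norm_num)
  refine ⟨⟨⟨ψ (θ₀, 2), hmem⟩, ?_⟩, ?_⟩
  · change ψ (θ₀, 2) ∉ _
    rw [mem_image_neck_iff (injective hψ)]
    exact fun h => by linarith [h.2]
  · have heq : farSet hψ = Subtype.val ⁻¹' (ψ '' (univ ×ˢ Icc (-1 : ℝ) 1))ᶜ := rfl
    rw [heq]
    refine (isPreconnected_compl_image_Icc hψ hψo hn hns).preimage_of_isOpenMap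
      Subtype.val_injective (P₁ hψ).2.isOpenMap_subtype_val ?_
    rw [Subtype.range_coe]
    exact compl_subset_compl.2 (image_neck_mono ψ (by
      rw [singleton_subset_iff]; exact ⟨by norm_num, by norm_num⟩))

/-- The second side `A₂ = inl₁ (U') ∪ (first disc)` is connected (`n ≠ 0`, `Y ∖ ψ (𝕊ⁿ × 0)`
connected): both pieces are, and they share `inl₁ ψ (θ₀, 3/2) = inr₁ (θ₀ / 2)`. [folklore] -/
theorem connectedSpace_sideTwo (hn : n ≠ 0)
    (hns : IsPreconnected (ψ '' (univ ×ˢ ({0} : Set ℝ)))ᶜ) :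
    ConnectedSpace (sideTwo hψ hψo) := by
  set D₁ := capOne hψ hψo with hD₁
  refine isConnected_iff_connectedSpace.1 ?_
  change IsConnected (D₁.inlSet (farSet hψ) ∪ range D₁.glueData.inr)
  obtain ⟨θ₀⟩ : Nonempty (sphere (0 : E) 1) := ⟨unitSpherePoint n⟩
  -- the common point
  have hhalf : (0 : ℝ) < 1 / 2 := by norm_num
  have hfar : (neckOne hψ (θ₀, 1 / 2) : P₁ hψ) ∈ farSet hψ := by
    change (neckOne hψ (θ₀, 1 / 2) : Y) ∉ _
    rw [coe_neckOne_of_mem_Icc hψ θ₀ ⟨hhalf.le, by norm_num⟩, mem_image_neck_iff (injective hψ)]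
    exact fun h => by linarith [h.2]
  have hcommon : D₁.glueData.inl ⟨neckOne hψ (θ₀, 1 / 2), D₁.mem_side θ₀ hhalf⟩ ∈
      D₁.inlSet (farSet hψ) ∩ range D₁.glueData.inr :=
    ⟨(NeckCapData.inl_mem_inlSet_iff _).2 hfar, by rw [D₁.inl_eq_inr θ₀ hhalf]; exact mem_range_self _⟩
  refine IsConnected.union ⟨_, hcommon⟩ ?_ (isConnected_range D₁.glueData.continuous_inr)
  -- `inlSet farSet` is connected: the image under `inl₁` of the preimage of `farSet` in `A₁`
  have hpre : IsConnected {a : sideOne hψ | (a : P₁ hψ) ∈ farSet hψ} := by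
    have hc := isConnected_farSet hψ hψo hn hns
    refine ⟨⟨⟨_, D₁.mem_side θ₀ hhalf⟩, hfar⟩, ?_⟩
    refine hc.isPreconnected.preimage_of_isOpenMap Subtype.val_injective
      (sideOne hψ).2.isOpenMap_subtype_val ?_
    rw [Subtype.range_coe]
    exact farSet_subset_sideOne hψ
  exact hpre.image _ D₁.glueData.continuous_inl.continuousOn

/-- **The double cap is connected** (`n ≠ 0`, `Y ∖ ψ (𝕊ⁿ × 0)` connected). [folklore] -/
theorem connectedSpace (hn : n ≠ 0) (hns : IsPreconnected (ψ '' (univ ×ˢ ({0} : Set ℝ)))ᶜ) :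
    ConnectedSpace (M hψ hψo) := by
  haveI : ConnectedSpace (capTwo hψ hψo).side := connectedSpace_sideTwo hψ hψo hn hns
  obtain ⟨θ₀⟩ : Nonempty (sphere (0 : E) 1) := ⟨unitSpherePoint n⟩
  refine (capTwo hψ hψo).glueData.connectedSpace_glued ⟨⟨neckTwo hψ hψo (θ₀, 1),
    (capTwo hψ hψo).mem_side θ₀ one_pos⟩, ?_⟩
  exact (capTwo hψ hψo).mem_glue_source.2 ((capTwo hψ hψo).mem_glueP_source.2 ⟨θ₀, 1, one_pos, rfl⟩)

/-! #### The fundamental group: `π₁ (Y ∖ ψ (𝕊ⁿ × [-1, 1])) ≅ π₁ (M)` -/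

open Literature.AlgebraicTopology.FundamentalGroup
open Literature.AlgebraicTopology.FundamentalGroup.VanKampen

omit [IsManifold 𝓘(ℝ, E) ∞ Y] in
/-- Points off `ψ (𝕊ⁿ × [-1, 1])` are off `ψ (𝕊ⁿ × 0)`. [folklore] -/
theorem mem_P₁_of_far {y : Y} (hy : y ∈ (ψ '' (univ ×ˢ Icc (-1 : ℝ) 1))ᶜ) : y ∈ P₁ hψ := fun h =>
  hy (image_neck_mono ψ (by rw [singleton_subset_iff]; exact ⟨by norm_num, by norm_num⟩) h)

omit [IsManifold 𝓘(ℝ, E) ∞ Y] in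
/-- Points off `ψ (𝕊ⁿ × [-1, 1])` are in the first side. [folklore] -/
theorem mk_mem_sideOne_of_far {y : Y} (hy : y ∈ (ψ '' (univ ×ˢ Icc (-1 : ℝ) 1))ᶜ) :
    (⟨y, mem_P₁_of_far hψ hy⟩ : P₁ hψ) ∈ sideOne hψ := fun h =>
  hy (image_neck_mono ψ (Icc_subset_Icc (by norm_num) le_rfl) h)

/-- **The far part of `Y` inside the second side**: `y ↦ inl₁ y`. [folklore] -/
def toSideTwo (y : ↥((ψ '' (univ ×ˢ Icc (-1 : ℝ) 1))ᶜ)) : sideTwo hψ hψo :=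
  ⟨(capOne hψ hψo).glueData.inl ⟨⟨y, mem_P₁_of_far hψ y.2⟩, mk_mem_sideOne_of_far hψ y.2⟩,
    Or.inl ((NeckCapData.inl_mem_inlSet_iff _).2 y.2)⟩

/-- Unfolding of `toSideTwo`. [folklore] -/
theorem coe_toSideTwo (y : ↥((ψ '' (univ ×ˢ Icc (-1 : ℝ) 1))ᶜ)) :
    (toSideTwo hψ hψo y : Q hψ hψo) =
      (capOne hψ hψo).glueData.inl ⟨⟨y, mem_P₁_of_far hψ y.2⟩, mk_mem_sideOne_of_far hψ y.2⟩ :=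
  rfl

/-- `toSideTwo` is a topological embedding. [folklore] -/
theorem isEmbedding_toSideTwo : IsEmbedding (toSideTwo hψ hψo) := by
  have hk : IsEmbedding (fun y : ↥((ψ '' (univ ×ˢ Icc (-1 : ℝ) 1))ᶜ) =>
      (⟨⟨(y : Y), mem_P₁_of_far hψ y.2⟩, mk_mem_sideOne_of_far hψ y.2⟩ : sideOne hψ)) :=
    (IsEmbedding.subtypeVal.codRestrict (P₁ hψ : Set Y) fun y => mem_P₁_of_far hψ y.2).codRestrict
      (sideOne hψ : Set (P₁ hψ)) fun y => mk_mem_sideOne_of_far hψ y.2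
  exact ((capOne hψ hψo).glueData.isOpenEmbedding_inl.isEmbedding.comp hk).codRestrict
    (sideTwo hψ hψo : Set (Q hψ hψo)) _

/-- The range of `toSideTwo` is the second side minus the centre `inr₁ 0` of the first disc.
[folklore] -/
theorem range_toSideTwo :
    range (toSideTwo hψ hψo) =
      {w : sideTwo hψ hψo | (w : Q hψ hψo) ≠ (capOne hψ hψo).glueData.inr 0} := by
  set D₁ := capOne hψ hψo with hD₁
  apply Subset.antisymm
  · rintro _ ⟨y, rfl⟩ (h : (toSideTwo hψ hψo y : Q hψ hψo) = _)
    have : (toSideTwo hψ hψo y : Q hψ hψo) ∈ range D₁.glueData.inl := ⟨_, rfl⟩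
    rw [h, D₁.range_inl] at this
    exact this rfl
  · intro w hw
    rcases w.2 with ⟨a, ha, haw⟩ | ⟨x, hx⟩
    · refine ⟨⟨((a : P₁ hψ) : Y), ha⟩, Subtype.ext ?_⟩
      rw [coe_toSideTwo, ← haw]
    · have hx0 : x ≠ 0 := by rintro rfl; exact hw hx.symm
      have hfar : (((D₁.glue.symm x : sideOne hψ) : P₁ hψ) : Y) ∈ (ψ '' (univ ×ˢ Icc (-1 : ℝ) 1))ᶜ := by
        rw [D₁.coe_glue_symm hx0]
        change (neckOne hψ (unitDir (unitSpherePoint n) x, ‖x‖) : Y) ∉ _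
        rw [coe_neckOne_apply, mem_image_neck_iff (injective hψ)]
        have h0 : intervalStretch 2 0 < intervalStretch 2 ‖x‖ :=
          strictMono_intervalStretch one_lt_two (norm_pos_iff.2 hx0)
        rw [intervalStretch_of_mem_Icc one_lt_two ⟨le_rfl, zero_le_one⟩] at h0
        exact fun h => by linarith [h.2]
      refine ⟨⟨_, hfar⟩, Subtype.ext ?_⟩
      rw [coe_toSideTwo, ← hx]
      exact D₁.glueData.inl_glue_symm (D₁.mem_glue_target.2 hx0)

/-- The first disc as a tube `Unit × E → A₂` over a point. [folklore] -/
def discOne (q : Unit × E) : sideTwo hψ hψo :=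
  ⟨(capOne hψ hψo).glueData.inr q.2, Or.inr (mem_range_self _)⟩

/-- The first disc is an open embedding into the second side. [folklore] -/
theorem isOpenEmbedding_discOne : IsOpenEmbedding (discOne hψ hψo) := by
  refine ⟨(((capOne hψ hψo).glueData.isOpenEmbedding_inr.isEmbedding.comp
    (Homeomorph.punitProd E).isEmbedding).codRestrict (sideTwo hψ hψo : Set (Q hψ hψo)) _), ?_⟩
  have : range (discOne hψ hψo) = Subtype.val ⁻¹' range (capOne hψ hψo).glueData.inr := by
    ext w
    constructor
    · rintro ⟨q, rfl⟩; exact ⟨q.2, rfl⟩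
    · rintro ⟨x, hx⟩; exact ⟨((), x), Subtype.ext hx⟩
  rw [this]
  exact (capOne hψ hψo).glueData.isOpen_range_inr.preimage continuous_subtype_val

/-- The complement of the core of the first disc is the second side minus the centre `inr₁ 0`. [folklore] -/
theorem compl_image_discOne :
    (discOne hψ hψo '' (univ ×ˢ ({0} : Set E)))ᶜ =
      {w : sideTwo hψ hψo | (w : Q hψ hψo) ≠ (capOne hψ hψo).glueData.inr 0} := by
  ext w
  simp only [mem_compl_iff, mem_image, mem_prod, mem_univ, true_and, mem_singleton_iff,
    Prod.exists, exists_eq_left, ne_eq, mem_setOf_eq, not_exists]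
  constructor
  · intro h hw
    exact h () (Subtype.ext hw.symm)
  · rintro h ⟨⟩ hw
    exact h (by rw [← hw]; rfl)

/-- The second disc as a tube `Unit × E → M` over a point. [folklore] -/
def discTwo (q : Unit × E) : M hψ hψo := (capTwo hψ hψo).glueData.inr q.2

/-- The second disc is an open embedding into `M`. [folklore] -/
theorem isOpenEmbedding_discTwo : IsOpenEmbedding (discTwo hψ hψo) :=
  (capTwo hψ hψo).glueData.isOpenEmbedding_inr.comp (Homeomorph.punitProd E).isOpenEmbedding

/-- The complement of the core of the second disc is the range of `inl₂`. [folklore] -/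
theorem compl_image_discTwo :
    (discTwo hψ hψo '' (univ ×ˢ ({0} : Set E)))ᶜ = range (capTwo hψ hψo).glueData.inl := by
  rw [(capTwo hψ hψo).range_inl]
  ext m
  simp only [mem_compl_iff, mem_image, mem_prod, mem_univ, true_and, mem_singleton_iff,
    Prod.exists, exists_eq_left, not_exists]
  constructor
  · intro h hm
    exact h () hm.symm
  · rintro h ⟨⟩ hm
    exact h hm.symm

/-- A product of simply connected spaces is simply connected (Hatcher 2002, Prop. 1.12).
[folklore] -/
private theorem simplyConnectedSpace_prod {A B : Type*} [TopologicalSpace A] [TopologicalSpace B]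
    [SimplyConnectedSpace A] [SimplyConnectedSpace B] : SimplyConnectedSpace (A × B) := by
  rw [simply_connected_iff_paths_homotopic]
  refine ⟨inferInstance, ?_⟩
  rintro ⟨a₁, b₁⟩ ⟨a₂, b₂⟩
  refine ⟨fun p q => ?_⟩
  rw [← Path.Homotopic.prod_projLeft_projRight p, ← Path.Homotopic.prod_projLeft_projRight q,
    Subsingleton.elim (Path.Homotopic.projLeft p) (Path.Homotopic.projLeft q),
    Subsingleton.elim (Path.Homotopic.projRight p) (Path.Homotopic.projRight q)]

/-- **Filling in the two cap centres does not change `π₁`** (`dim = n + 1 ≥ 3`): the far part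
`U' = Y ∖ ψ (𝕊ⁿ × [-1, 1])` embeds in `M` onto the complement of the two disc centres, and a point
of a manifold of dimension `≥ 3` has simply connected punctured neighbourhoods, so
`π₁ (U') ≅ π₁ (M ∖ {c₁, c₂}) ≅ π₁ (M)` (`VanKampen.bijective_inclHom_compl_core`, twice).  The
base points are `ψ (θ₀, 3/2) ∈ U'` and the point `inr₂ (θ₀ / 2)` of the second disc.
[cite: Kosinski1993, Ch. VI §2] -/
theorem exists_mulEquiv_fundamentalGroup_far [SimplyConnectedSpace ↥(({0} : Set E)ᶜ)]
    (hn : n ≠ 0) (hns : IsPreconnected (ψ '' (univ ×ˢ ({0} : Set ℝ)))ᶜ)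
    (θ₀ : sphere (0 : E) 1) :
    ∃ (h₀ : ψ (θ₀, 3 / 2) ∈ (ψ '' (univ ×ˢ Icc (-1 : ℝ) 1))ᶜ),
      Nonempty (_root_.FundamentalGroup ↥((ψ '' (univ ×ˢ Icc (-1 : ℝ) 1))ᶜ) ⟨ψ (θ₀, 3 / 2), h₀⟩ ≃*
        _root_.FundamentalGroup (M hψ hψo)
          ((capTwo hψ hψo).glueData.inr ((1 / 2 : ℝ) • (θ₀ : E)))) := by
  haveI : FiniteDimensional ℝ E := .of_fact_finrank_eq_succ (K := ℝ) (V := E) n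
  set D₁ := capOne hψ hψo with hD₁
  set D₂ := capTwo hψ hψo with hD₂
  have hhalf : (0 : ℝ) < 1 / 2 := by norm_num
  have hv₀ : ((1 / 2 : ℝ) • (θ₀ : E)) ≠ 0 :=
    smul_ne_zero hhalf.ne' (ne_zero_of_mem_unit_sphere θ₀)
  have hy₀ : (neckOne hψ (θ₀, 1 / 2) : Y) = ψ (θ₀, 3 / 2) := by
    rw [coe_neckOne_of_mem_Icc hψ θ₀ ⟨hhalf.le, by norm_num⟩]; norm_num
  have h₀ : ψ (θ₀, 3 / 2) ∈ (ψ '' (univ ×ˢ Icc (-1 : ℝ) 1))ᶜ := by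
    rw [mem_compl_iff, mem_image_neck_iff (injective hψ)]
    exact fun h => by linarith [h.2]
  refine ⟨h₀, ?_⟩
  -- path-connectedness of the second side and of `M`
  haveI : ConnectedSpace (sideTwo hψ hψo) := connectedSpace_sideTwo hψ hψo hn hns
  haveI : LocallyPathConnectedSpace (sideTwo hψ hψo) :=
    ChartedSpace.locallyPathConnectedSpace E (sideTwo hψ hψo)
  haveI : PathConnectedSpace (sideTwo hψ hψo) := .of_locallyPathConnectedSpace
  haveI : ConnectedSpace (M hψ hψo) := connectedSpace hψ hψo hn hns
  haveI : LocallyPathConnectedSpace (M hψ hψo) := ChartedSpace.locallyPathConnectedSpace E (M hψ hψo)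
  haveI : PathConnectedSpace (M hψ hψo) := .of_locallyPathConnectedSpace
  -- Step 1: `U' ≅ A₂ ∖ {c₁}` along `toSideTwo`
  have hS₁ : range (toSideTwo hψ hψo) = (discOne hψ hψo '' (univ ×ˢ ({0} : Set E)))ᶜ := by
    rw [range_toSideTwo, compl_image_discOne]
  let η₁ : ↥((ψ '' (univ ×ˢ Icc (-1 : ℝ) 1))ᶜ) ≃ₜ ↥((discOne hψ hψo '' (univ ×ˢ ({0} : Set E)))ᶜ) :=
    (isEmbedding_toSideTwo hψ hψo).toHomeomorph.trans (Homeomorph.setCongr hS₁)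
  have hq₁ : (((), (1 / 2 : ℝ) • (θ₀ : E)) : Unit × E).2 ≠ 0 := hv₀
  have hbase₁ : discOne hψ hψo ((), (1 / 2 : ℝ) • (θ₀ : E)) ∉
      discOne hψ hψo '' (univ ×ˢ ({0} : Set E)) := by
    rw [← mem_compl_iff, compl_image_discOne]
    exact fun h => hv₀ (D₁.glueData.inr_injective h)
  have hη₁ : η₁ ⟨ψ (θ₀, 3 / 2), h₀⟩ = ⟨discOne hψ hψo ((), (1 / 2 : ℝ) • (θ₀ : E)), hbase₁⟩ := by
    apply Subtype.ext; apply Subtype.ext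
    change (toSideTwo hψ hψo ⟨ψ (θ₀, 3 / 2), h₀⟩ : Q hψ hψo) = D₁.glueData.inr ((1 / 2 : ℝ) • (θ₀ : E))
    rw [coe_toSideTwo, ← D₁.inl_eq_inr θ₀ hhalf]
    congr 1
    apply Subtype.ext; apply Subtype.ext
    exact hy₀.symm
  have e₁ := fundamentalGroupEquivOfHomeomorph η₁ hη₁
  -- Step 2: fill in `c₁`
  have hbij₁ := bijective_inclHom_compl_core (Z := Unit) (isOpenEmbedding_discOne hψ hψo)
    (q₀ := ((), (1 / 2 : ℝ) • (θ₀ : E))) hq₁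
  have e₂ := MulEquiv.ofBijective _ hbij₁
  -- Step 3: move the base point to the second neck
  let w₁ : sideTwo hψ hψo := ⟨neckTwo hψ hψo (θ₀, 1 / 2), D₂.mem_side θ₀ hhalf⟩
  have e₃ := FundamentalGroup.fundamentalGroupMulEquivOfPathConnected
    (discOne hψ hψo ((), (1 / 2 : ℝ) • (θ₀ : E))) w₁
  -- Step 4: `A₂ ≅ M ∖ {c₂}` along `inl₂`
  have hS₂ : range D₂.glueData.inl = (discTwo hψ hψo '' (univ ×ˢ ({0} : Set E)))ᶜ :=
    (compl_image_discTwo hψ hψo).symm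
  let η₂ : sideTwo hψ hψo ≃ₜ ↥((discTwo hψ hψo '' (univ ×ˢ ({0} : Set E)))ᶜ) :=
    D₂.glueData.isOpenEmbedding_inl.isEmbedding.toHomeomorph.trans (Homeomorph.setCongr hS₂)
  have hq₂ : (((), (1 / 2 : ℝ) • (θ₀ : E)) : Unit × E).2 ≠ 0 := hv₀
  have hbase₂ : discTwo hψ hψo ((), (1 / 2 : ℝ) • (θ₀ : E)) ∉
      discTwo hψ hψo '' (univ ×ˢ ({0} : Set E)) := by
    rw [← mem_compl_iff, compl_image_discTwo, D₂.range_inl]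
    exact fun h => hv₀ (D₂.glueData.inr_injective h)
  have hη₂ : η₂ w₁ = ⟨discTwo hψ hψo ((), (1 / 2 : ℝ) • (θ₀ : E)), hbase₂⟩ := by
    apply Subtype.ext
    change D₂.glueData.inl w₁ = D₂.glueData.inr ((1 / 2 : ℝ) • (θ₀ : E))
    exact D₂.inl_eq_inr θ₀ hhalf
  have e₄ := fundamentalGroupEquivOfHomeomorph η₂ hη₂
  -- Step 5: fill in `c₂`
  have hbij₂ := bijective_inclHom_compl_core (Z := Unit) (isOpenEmbedding_discTwo hψ hψo)
    (q₀ := ((), (1 / 2 : ℝ) • (θ₀ : E))) hq₂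
  have e₅ := MulEquiv.ofBijective _ hbij₂
  exact ⟨e₁.trans (e₂.trans (e₃.trans (e₄.trans e₅)))⟩

/-! #### Seifert–van Kampen: `π₁ (Y) ≅ π₁ (Y ∖ ψ (𝕊ⁿ × [-1, 1])) ∗ ℤ` -/

include hψ in
omit [T2Space Y] [IsManifold 𝓘(ℝ, E) ∞ Y] in
/-- Tubes `ψ (𝕊ⁿ × (a, b))` are simply connected for `n ≥ 2`. [folklore] -/
theorem isSimplyConnected_image_Ioo (hn : 2 ≤ n) {a b : ℝ} (hab : a < b) :
    IsSimplyConnected (ψ '' (univ ×ˢ Ioo a b)) := by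
  rw [hψ.isEmbedding.isSimplyConnected_image]
  haveI := simplyConnectedSpace_sphere (E := E) hn
  haveI : ContractibleSpace (Ioo a b) := (convex_Ioo a b).contractibleSpace (nonempty_Ioo.2 hab)
  haveI : SimplyConnectedSpace ((univ : Set (sphere (0 : E) 1))) :=
    (Homeomorph.Set.univ (sphere (0 : E) 1)).toHomotopyEquiv.simplyConnectedSpace_iff.2 inferInstance
  haveI : SimplyConnectedSpace (↥(univ : Set (sphere (0 : E) 1)) × ↥(Ioo a b)) :=
    simplyConnectedSpace_prod
  exact (Homeomorph.Set.prod (univ : Set (sphere (0 : E) 1)) (Ioo a b)).toHomotopyEquiv.simplyConnectedSpace_iff.2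
    inferInstance

include hψ hψo in
omit [IsManifold 𝓘(ℝ, E) ∞ Y] in
/-- **`π₁ (Y) ≅ π₁ (Y ∖ ψ (𝕊ⁿ × [-1, 1])) ∗ ℤ` for a non-separating neck** (`n ≥ 2`):
Seifert–van Kampen in the HNN form `VanKampen.fundamentalGroupEquivCoprodInt` for the cover of
`Y` by `U' = Y ∖ ψ (𝕊ⁿ × [-1, 1])` and the simply connected tube `ψ (𝕊ⁿ × (-2, 2))`, which meet
in the two simply connected collars `ψ (𝕊ⁿ × (1, 2))`, `ψ (𝕊ⁿ × (-2, -1))`; the base point is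
`ψ (θ₀, 3/2)` and the stable letter is the class of a loop crossing the sphere once.
[cite: HatcherAT2002, Thm. 1.20 and §1.B] -/
theorem exists_mulEquiv_fundamentalGroup_coprodInt (hn : 2 ≤ n)
    (hns : IsPreconnected (ψ '' (univ ×ˢ ({0} : Set ℝ)))ᶜ) (θ₀ : sphere (0 : E) 1) :
    ∃ (h₀ : ψ (θ₀, 3 / 2) ∈ (ψ '' (univ ×ˢ Icc (-1 : ℝ) 1))ᶜ),
      Nonempty (_root_.FundamentalGroup Y (ψ (θ₀, 3 / 2)) ≃*
        Monoid.Coprod (_root_.FundamentalGroup ↥((ψ '' (univ ×ˢ Icc (-1 : ℝ) 1))ᶜ)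
          ⟨ψ (θ₀, 3 / 2), h₀⟩) (Multiplicative ℤ)) := by
  haveI : FiniteDimensional ℝ E := .of_fact_finrank_eq_succ (K := ℝ) (V := E) n
  haveI : LocallyPathConnectedSpace Y := ChartedSpace.locallyPathConnectedSpace E Y
  have hinj := injective hψ
  have hcont : Continuous ψ := hψ.isEmbedding.continuous
  set U := (ψ '' (univ ×ˢ Icc (-1 : ℝ) 1))ᶜ with hUdef
  set T := ψ '' (univ ×ˢ Ioo (-2 : ℝ) 2) with hTdef
  set C₁ := ψ '' (univ ×ˢ Ioo (1 : ℝ) 2) with hC₁def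
  set C₂ := ψ '' (univ ×ˢ Ioo (-2 : ℝ) (-1)) with hC₂def
  have hUo : IsOpen U := (isClosed_image hψ isCompact_Icc).isOpen_compl
  have hTo : IsOpen T := isOpen_image hψ hψo isOpen_Ioo
  have hC₁o : IsOpen C₁ := isOpen_image hψ hψo isOpen_Ioo
  have hC₂o : IsOpen C₂ := isOpen_image hψ hψo isOpen_Ioo
  have hmemU : ∀ {θ : sphere (0 : E) 1} {t : ℝ}, ψ (θ, t) ∈ U ↔ t ∉ Icc (-1 : ℝ) 1 := by
    intro θ t; rw [hUdef, mem_compl_iff, mem_image_neck_iff hinj]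
  have hcov : U ∪ T = univ := by
    refine eq_univ_of_forall fun y => ?_
    by_cases hy : y ∈ U
    · exact Or.inl hy
    rw [hUdef, mem_compl_iff, not_not] at hy
    obtain ⟨⟨θ, t⟩, ⟨-, ht⟩, rfl⟩ := hy
    exact Or.inr ((mem_image_neck_iff hinj).2 ⟨by linarith [ht.1], by linarith [ht.2]⟩)
  have hdisj : Disjoint C₁ C₂ := disjoint_image_neck hinj (by
    rw [Set.disjoint_left]; rintro t ⟨h1, -⟩ ⟨-, h2⟩; linarith)
  have hinter : U ∩ T = C₁ ∪ C₂ := by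
    apply Subset.antisymm
    · rintro _ ⟨hU, ⟨⟨θ, t⟩, ⟨-, ht⟩, rfl⟩⟩
      rw [hmemU] at hU
      rcases lt_or_ge t (-1) with h | h
      · exact Or.inr ((mem_image_neck_iff hinj).2 ⟨ht.1, h⟩)
      · exact Or.inl ((mem_image_neck_iff hinj).2 ⟨lt_of_not_ge fun h' => hU ⟨h, h'⟩, ht.2⟩)
    · rintro _ (⟨⟨θ, t⟩, ⟨-, ht⟩, rfl⟩ | ⟨⟨θ, t⟩, ⟨-, ht⟩, rfl⟩)
      · exact ⟨hmemU.2 fun h => by linarith [h.2, ht.1],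
          (mem_image_neck_iff hinj).2 ⟨by linarith [ht.1], ht.2⟩⟩
      · exact ⟨hmemU.2 fun h => by linarith [h.1, ht.2],
          (mem_image_neck_iff hinj).2 ⟨ht.1, by linarith [ht.2]⟩⟩
  have hx₀ : ψ (θ₀, 3 / 2) ∈ C₁ := (mem_image_neck_iff hinj).2 ⟨by norm_num, by norm_num⟩
  have hxU : ψ (θ₀, 3 / 2) ∈ U := hmemU.2 fun h => by linarith [h.2]
  have hxT : ψ (θ₀, 3 / 2) ∈ T := (mem_image_neck_iff hinj).2 ⟨by norm_num, by norm_num⟩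
  have hc₂ : ψ (θ₀, -3 / 2) ∈ C₂ := (mem_image_neck_iff hinj).2 ⟨by norm_num, by norm_num⟩
  have hc₂U : ψ (θ₀, -3 / 2) ∈ U := hmemU.2 fun h => by linarith [h.1]
  have hUpc : IsPathConnected U :=
    (hUo.isConnected_iff_isPathConnected).1
      ⟨⟨_, hxU⟩, isPreconnected_compl_image_Icc hψ hψo (by omega) hns⟩
  have hTsc : IsSimplyConnected T := isSimplyConnected_image_Ioo hψ hn (by norm_num)
  have h₁ : IsSimplyConnected C₁ := isSimplyConnected_image_Ioo hψ hn (by norm_num)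
  have h₂ : IsSimplyConnected C₂ := isSimplyConnected_image_Ioo hψ hn (by norm_num)
  -- the connecting paths
  let ηT : Path (ψ (θ₀, 3 / 2)) (ψ (θ₀, -3 / 2)) :=
    { toFun := fun t => ψ (θ₀, 3 / 2 - 3 * (t : ℝ))
      continuous_toFun := hcont.comp (continuous_const.prodMk
        (continuous_const.sub (continuous_const.mul continuous_subtype_val)))
      source' := by simp
      target' := by simp only [Set.Icc.coe_one, mul_one]; norm_num }
  have hηT : ∀ t, ηT t ∈ T := fun t => by
    change ψ (θ₀, 3 / 2 - 3 * (t : ℝ)) ∈ T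
    exact (mem_image_neck_iff hinj).2 ⟨by linarith [t.2.2], by linarith [t.2.1]⟩
  have hJ : JoinedIn U (ψ (θ₀, 3 / 2)) (ψ (θ₀, -3 / 2)) := hUpc.joinedIn _ hxU _ hc₂U
  exact ⟨hxU, ⟨fundamentalGroupEquivCoprodInt hUo hTo hcov hC₁o hC₂o hdisj hinter hx₀ hxU hxT hc₂
    hUpc hTsc h₁ h₂ hJ.somePath hJ.somePath_mem ηT hηT⟩⟩

/-- **`π₁ (Y) ≅ π₁ (M) ∗ ℤ`**: the fundamental group of a manifold with a non-separating neck
(`n ≥ 2`) is the free product of the fundamental group of the double cap `M` with `ℤ`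
(Hempel 1976, Lemma 3.8 with Thm. 3.15's discussion: `Y = M # handle`; Stallings 1971, 1.B).
[cite: Hempel1976, Ch. 3, Lemma 3.8] -/
theorem nonempty_mulEquiv_fundamentalGroup_coprod (hn : 2 ≤ n)
    (hns : IsPreconnected (ψ '' (univ ×ˢ ({0} : Set ℝ)))ᶜ) (θ₀ : sphere (0 : E) 1) :
    Nonempty (_root_.FundamentalGroup Y (ψ (θ₀, 3 / 2)) ≃*
      Monoid.Coprod (_root_.FundamentalGroup (M hψ hψo)
        ((capTwo hψ hψo).glueData.inr ((1 / 2 : ℝ) • (θ₀ : E)))) (Multiplicative ℤ)) := by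
  haveI : FiniteDimensional ℝ E := .of_fact_finrank_eq_succ (K := ℝ) (V := E) n
  haveI : SimplyConnectedSpace ↥(({0} : Set E)ᶜ) :=
    Literature.AlgebraicTopology.FundamentalGroupoid.isSimplyConnected_compl_singleton_of_isOpenEmbedding
      (M := E) (i := id) IsOpenEmbedding.id
      (by rw [(Fact.out : finrank ℝ E = n + 1)]; omega)
  obtain ⟨h₀, ⟨e₁⟩⟩ := exists_mulEquiv_fundamentalGroup_coprodInt hψ hψo hn hns θ₀
  obtain ⟨h₀', ⟨e₂⟩⟩ := exists_mulEquiv_fundamentalGroup_far hψ hψo (by omega) hns θ₀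
  exact ⟨e₁.trans (MulEquiv.coprodCongr e₂ (MulEquiv.refl _))⟩

end DoubleCap

/-! ### Dimension three -/

section Three

/-- Local notation: `𝔼 n` is the model Euclidean space `EuclideanSpace ℝ (Fin n)`. -/
local notation "𝔼 " n:arg => EuclideanSpace ℝ (Fin n)

/-- Local notation: `𝕊 n` is the unit sphere in `EuclideanSpace ℝ (Fin (n + 1))`. -/
local notation "𝕊 " n:arg => (Metric.sphere (0 : EuclideanSpace ℝ (Fin (n + 1))) 1)

attribute [local instance] fact_finrank_euclideanSpace_succ

/-- **Cutting a closed, connected, orientable `3`-manifold along a non-separating sphere with a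
product neighbourhood and capping off** (Hempel, *3-Manifolds* (1976), Lemma 3.8, non-separating
case; smooth category).  If `ψ : S² × ℝ ↪ Y` is a neck whose middle sphere does not separate
`Y`, then the double cap `M` is a closed, connected, orientable smooth `3`-manifold and
`π₁ (Y) ≅ π₁ (M) ∗ ℤ`. [cite: Hempel1976, Ch. 3, Lemma 3.8] -/
theorem exists_closed_mulEquiv_coprod_int_of_nonseparating_three {Y : Type} [TopologicalSpace Y]
    [T2Space Y] [ChartedSpace (𝔼 3) Y] [IsManifold (𝓡 3) ∞ Y] [CompactSpace Y] [ConnectedSpace Y]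
    (hY : IsOrientable (𝓡 3) Y) {ψ : (𝕊 2) × ℝ → Y}
    (hψ : Manifold.IsSmoothEmbedding ((𝓡 2).prod 𝓘(ℝ, ℝ)) (𝓡 3) ∞ ψ) (hψo : IsOpen (range ψ))
    (hns : IsPreconnected (ψ '' (univ ×ˢ {(0 : ℝ)}))ᶜ) :
    ∃ (M : Type) (_ : TopologicalSpace M) (_ : T2Space M) (_ : SecondCountableTopology M)
      (_ : ChartedSpace (𝔼 3) M) (_ : IsManifold (𝓡 3) ∞ M) (_ : CompactSpace M)
      (_ : ConnectedSpace M), IsOrientable (𝓡 3) M ∧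
      ∃ (y : Y) (m : M), Nonempty (FundamentalGroup Y y ≃*
        Monoid.Coprod (FundamentalGroup M m) (Multiplicative ℤ)) := by
  obtain ⟨e⟩ := DoubleCap.nonempty_mulEquiv_fundamentalGroup_coprod hψ hψo le_rfl hns
    (unitSpherePoint 2)
  exact ⟨DoubleCap.M hψ hψo, inferInstance, inferInstance, DoubleCap.secondCountableTopology hψ hψo,
    inferInstance, inferInstance, DoubleCap.compactSpace hψ hψo,
    DoubleCap.connectedSpace hψ hψo two_ne_zero hns, DoubleCap.isOrientable hψ hψo hY two_ne_zero,
    _, _, ⟨e⟩⟩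

end Three

end Literature.Topology.FourManifolds
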